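import Literature.Analysis.FluidPDE.Tao2016AveragedNS.NegativeKickThreshold
import Literature.Analysis.FluidPDE.Tao2016AveragedNS.ReachConeWide
import HarnessLib

/-!
# The critical line of Tao's gate: necessity off the axes via the reduced-seed dud

**Honest framing.** low prior, high value-of-information experiment on Tao's machine paradigm; NOT a
claim that NS blows up. This file is Literature-side bookkeeping for the cell `pub-fluidc`: it
formalises the NECESSITY side of [cite: Tao2016AveragedNS, §5.5 Theorem 5.3] (the delayed, abrupt
firing of the five-mode quadratic circuit (5.5)) read through bp3's typed `ReachCertificate`
interface — which datum / forcing tolerances `(ρ, ε_d)` a Theorem-5.3 stage can certify AT ALL.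
Nothing here is a statement about the Navier–Stokes equations.

**What is new relative to `ReachHalfPlane.lean`, `ReachConeWide.lean`, `NegativeKickThreshold.lean`.**
Those files decide the reach question for the member `delayCircuitWith K M ε` on the two AXES of
the tolerance quadrant (pre-load axis: certified for `ρ < 1.2532·u`, impossible for `ρ ≥ 1.2535·u`,
`u = ε²e^{-M}/√M`; forcing axis: certified for `ε_d < 0.9867·s`, impossible for `ε_d ≥ s`,
`s = ε²e^{-M}`) and certify the whole open weighted half-plane `ρ + 1.27·ε_d/√M < 1.2532·u`. Off the
axes the necessity side was open: the only adversaries in the tree were EXACT orbits (the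
negative-kick dud: zero forcing) and the seed-free orbit (forcing of the full seed size `s`). This
file supplies the interpolating ONE-PARAMETER FAMILY OF ADVERSARIES and closes the quadrant up to a
thin wedge:

* §1 `delayCircuitSeed K M ε ν` — the member with its seed coupling turned down to `s·e^{-ν²}`
  (all other couplings untouched; `ν = 0` is the member, `delayCircuitSeed_zero`); it is a
  cancelling gate superposition, hence globally well posed with conserved energy (`delayFlowSeed`).
* §2–§4 (ports, suffix `S`, of `NegativeKick` / `NegativeKickSharp` / `NegativeKickThreshold` with
  the seed coupling as the only change): its kicked trajectories obey the same a-priori bounds, and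
  its dud threshold is PROPORTIONAL TO THE DEPOSITED SEED: every pre-load
  `κ ≥ 1.2535·s·e^{-ν²}/√M` ends the cycle with a negative trigger
  (`cycleEndTrigger_neg_of_ge_fineS`), so there is a dud pre-load `κ* < 1.2535·s·e^{-ν²}/√M` whose
  exact reduced-seed flow has `c(2) = 0`, `c ≤ 0` and `|d|, |ã| ≤ 6e^{-M}` on `[0,2]`
  (`exists_seedDud`).
* §5 the adversary: that exact flow line is a PSEUDO-ORBIT OF THE MEMBER with forcing
  `s(1 - e^{-ν²})·(ac, 0, -a², 0, 0)`, of sup-size `≤ s(1 - e^{-ν²})` (`delayCircuitSeed_sub`,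
  `norm_delayCircuitSeed_sub_le`); by quadratic homogeneity the level-`c₀` copy `t ↦ c₀·x(c₀t)` is one
  with forcing `≤ c₀²s(1 - e^{-ν²})`. Hence (`isEmpty_reachCertificate_of_seedDud`, general classes;
  `isEmpty_taoReachCone_of_seedDud`, cone classes) NO reach certificate with cycle time `≤ 2/c₀`
  exists once `ρ ≥ 1.2535·s·e^{-ν²}/√M` and `ε_d ≥ c₀²s(1 - e^{-ν²})`. Eliminating `ν`
  (`e^{-ν²} = 1 - ε_d/(c₀²s)`): NONE exists at any `(ρ, ε_d)` ON OR ABOVE THE STRAIGHT LINE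
  `ρ + 1.2535·(ε_d/c₀²)/√M = 1.2535·u` through the two axis thresholds
  (`isEmpty_taoReachCone_of_line_le`, every level; `isEmpty_taoReach_of_line_le`, level one, the
  ball classes of `taoReachHalfPlane`).

**The portrait** (`taoReach_phases_line`, `taoReachCone_phases_line`, `undecided_wedge`): certified
strictly below `ρ + 1.27·(ε_d/c₀²)/√M = 1.2532·u`, impossible on or above
`ρ + 1.2535·(ε_d/c₀²)/√M = 1.2535·u`; the undecided set is the wedge between two straight lines
whose intercepts differ by the factors `1.2535/1.2532 = 1.0002` on the pre-load axis and
`1.2535/1.2532 · 1.27/1.2535 = 1.0134` on the forcing axis. DICTIONARY READING: for a Theorem-5.3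
stage, datum error and adversarial forcing are interchangeable at the fixed exchange rate
`≈ 1.25/√M = ∫₀² e^{-G}` (the Gaussian clock-propagator mass): forcing reaches the trigger only
through the discounted integral, on the sufficiency side (`1.27/√M`) as on the necessity side
(`1.2535/√M`). The tolerance of the gate is ONE weighted budget, not two.

**What is NOT claimed.** The wedge stays undecided (closing it needs the next digit of the window
mass `√(π/(2M))·(1 + O(M^{-1/2}))` on both sides); no necessity for cycle times `> 2/c₀` (the dud
re-arms after the cycle); the lower pin of the reduced-seed dud (`κ* ≥ 1.2532·s·e^{-ν²}/√M`, cf.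
`exists_negativeKick_dud_pinned`) is not ported — necessity does not need it; nothing about
Navier–Stokes.

Layout. §1 the reduced-seed member and its flow. §2 a-priori bounds on kicked trajectories
(`namespace NegKick`, suffix `S`). §3 cycle-end trigger and the dud by continuity. §4 the fine clock
and the dud threshold. §5 the adversary, necessity off the axes, the portrait.
-/


noncomputable section

open Real Set MeasureTheory Metric Filter
open scoped NNReal Topology
open Literature.Analysis.FluidPDE.FluidComputer (ReachCertificate)

namespace Literature.Analysis.FluidPDE.Tao2016AveragedNS

/-! ## §1. The reduced-seed member `delayCircuitSeed K M ε ν` and its flow -/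

/-- **The reduced-seed member**: Tao's retuned delay circuit `delayCircuitWith K M ε` with the seed
pump `a → c` turned DOWN from `ε²e^{-M}` to `ε²e^{-M}e^{-ν²}` (`ν` real; `ν = 0` is the member
itself), every other coupling — clock pump `ε`, amplifier `ε⁻¹M`, rotor `ε⁻²`, drain `K` — untouched:
`∂ₜa = -ε⁻²cd - εab - ε²e^{-M}e^{-ν²}ac`, `∂ₜb = εa² - ε⁻¹Mc²`, `∂ₜc = ε²e^{-M}e^{-ν²}a² + ε⁻¹Mbc`,
`∂ₜd = ε⁻²ca - Kdã`, `∂ₜã = Kd²`. Its exact flow lines are the adversarial pseudo-orbits of the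
member with forcing of sup-size `ε²e^{-M}(1 - e^{-ν²})` (§5). [cite: Tao2016AveragedNS, §5.5 (5.5)] -/
def delayCircuitSeed (K M ε ν : ℝ) (X : Fin 5 → ℝ) : Fin 5 → ℝ :=
  ![-((ε ^ 2)⁻¹ * X 2 * X 3) - ε * X 0 * X 1 - ε ^ 2 * Real.exp (-M) * Real.exp (-ν ^ 2) * X 0 * X 2,
    ε * X 0 ^ 2 - ε⁻¹ * M * X 2 ^ 2,
    ε ^ 2 * Real.exp (-M) * Real.exp (-ν ^ 2) * X 0 ^ 2 + ε⁻¹ * M * X 1 * X 2,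
    (ε ^ 2)⁻¹ * X 2 * X 0 - K * X 3 * X 4,
    K * X 3 ^ 2]

/-- At `ν = 0` the reduced-seed member is the member. [cite: Tao2016AveragedNS, §5.5 (5.5)] -/
theorem delayCircuitSeed_zero (K M ε : ℝ) : delayCircuitSeed K M ε 0 = delayCircuitWith K M ε := by
  funext X; ext l
  fin_cases l <;> simp [delayCircuitSeed, delayCircuitWith]

/-- The reduced-seed member is the superposition of the same five gates, with seed coupling
`ε²e^{-M}e^{-ν²}`. [cite: Tao2016AveragedNS, §5.5] -/
theorem delayCircuitSeed_eq_gates (K M ε ν : ℝ) :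
    delayCircuitSeed K M ε ν = pumpOn ε 0 1 + pumpOn (ε ^ 2 * Real.exp (-M) * Real.exp (-ν ^ 2)) 0 2 +
      amplifierOn (ε⁻¹ * M) 1 2 + rotorOn ((ε ^ 2)⁻¹) 0 3 2 + pumpOn K 3 4 := by
  funext X; ext l
  fin_cases l <;> simp [delayCircuitSeed, pumpOn, amplifierOn, rotorOn] <;> ring

/-- The reduced-seed member cancels. [cite: Tao2016AveragedNS, §5.5] -/
theorem isCancelling_delayCircuitSeed (K M ε ν : ℝ) : IsCancelling (delayCircuitSeed K M ε ν) := by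
  rw [delayCircuitSeed_eq_gates]
  exact ((((isCancelling_pumpOn _ _ _).add (isCancelling_pumpOn _ _ _)).add
    (isCancelling_amplifierOn _ _ _)).add (isCancelling_rotorOn _ _ _ _)).add
    (isCancelling_pumpOn _ _ _)

/-- The reduced-seed member is a smooth vector field. [cite: Tao2016AveragedNS, §5.5 (5.5)] -/
theorem contDiff_delayCircuitSeed (K M ε ν : ℝ) {n : WithTop ℕ∞} :
    ContDiff ℝ n (delayCircuitSeed K M ε ν) := by
  rw [delayCircuitSeed_eq_gates]
  exact ((((contDiff_pumpOn _ _ _).add (contDiff_pumpOn _ _ _)).add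
    (contDiff_amplifierOn _ _ _)).add (contDiff_rotorOn _ _ _ _)).add (contDiff_pumpOn _ _ _)

/-- Energy conservation along any trajectory of the reduced-seed member.
[cite: Tao2016AveragedNS, §5.5 (energy-con)] -/
theorem delayCircuitSeed_energy {K M ε ν : ℝ} {X : ℝ → Fin 5 → ℝ}
    (hX : ∀ t, HasDerivAt X (delayCircuitSeed K M ε ν (X t)) t) (t t₀ : ℝ) :
    energy (X t) = energy (X t₀) :=
  energy_eq_of_isCancelling (isCancelling_delayCircuitSeed K M ε ν) hX t t₀

/-- The reduced-seed member is Lipschitz on the sup-ball of radius `R` with the SAME explicit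
constant `delayLipschitzWith K M ε R` as the member (its seed coupling is smaller).
[cite: Tao2016AveragedNS, §5.5 (5.5)] -/
theorem lipschitzOnWith_delayCircuitSeed (K M ε ν : ℝ) (R : ℝ≥0) :
    LipschitzOnWith (delayLipschitzWith K M ε R) (delayCircuitSeed K M ε ν)
      (closedBall (0 : Fin 5 → ℝ) R) := by
  rw [delayCircuitSeed_eq_gates]
  refine (((((lipschitzOnWith_pumpOn ε 0 1 R).add
    (lipschitzOnWith_pumpOn (ε ^ 2 * Real.exp (-M) * Real.exp (-ν ^ 2)) 0 2 R)).add
    (lipschitzOnWith_amplifierOn (ε⁻¹ * M) 1 2 R)).add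
    (lipschitzOnWith_rotorOn ((ε ^ 2)⁻¹) 0 3 2 R)).add (lipschitzOnWith_pumpOn K 3 4 R)).weaken ?_
  have h : ‖ε ^ 2 * Real.exp (-M) * Real.exp (-ν ^ 2)‖₊ ≤ ‖ε ^ 2 * Real.exp (-M)‖₊ := by
    rw [← NNReal.coe_le_coe, coe_nnnorm, coe_nnnorm, norm_mul]
    have h1 : ‖Real.exp (-ν ^ 2)‖ ≤ 1 := by
      rw [Real.norm_eq_abs, abs_of_pos (Real.exp_pos _), Real.exp_le_one_iff]
      nlinarith [sq_nonneg ν]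
    exact mul_le_of_le_one_right (norm_nonneg _) h1
  unfold delayLipschitzWith
  gcongr

/-- Uniqueness among global trajectories of the reduced-seed member. [cite: Tao2016AveragedNS, §5 (ode)–(g-cancel)] -/
theorem delayCircuitSeed_solution_unique (K M ε ν : ℝ) {X Y : ℝ → Fin 5 → ℝ}
    (hX : ∀ t, HasDerivAt X (delayCircuitSeed K M ε ν (X t)) t)
    (hY : ∀ t, HasDerivAt Y (delayCircuitSeed K M ε ν (Y t)) t) (h : X 0 = Y 0) : X = Y :=
  (isCancelling_delayCircuitSeed K M ε ν).solution_unique (contDiff_delayCircuitSeed K M ε ν) hX hY h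

/-- The reduced-seed member is globally well posed from every state. [cite: Tao2016AveragedNS, §5 (ode)–(g-cancel)] -/
theorem delayCircuitSeed_exists_solution_from (K M ε ν : ℝ) (p : Fin 5 → ℝ) :
    ∃ X : ℝ → Fin 5 → ℝ, X 0 = p ∧ ∀ t, HasDerivAt X (delayCircuitSeed K M ε ν (X t)) t :=
  (isCancelling_delayCircuitSeed K M ε ν).exists_solution (contDiff_delayCircuitSeed K M ε ν) p

/-- **The flow of the reduced-seed member** (definition by choice, characterised by
`delayFlowSeed_zero`, `hasDerivAt_delayFlowSeed` and uniqueness). [cite: Tao2016AveragedNS, §5.5 (5.5)] -/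
noncomputable def delayFlowSeed (K M ε ν : ℝ) (σ : ℝ) (p : Fin 5 → ℝ) : Fin 5 → ℝ :=
  (delayCircuitSeed_exists_solution_from K M ε ν p).choose σ

/-- The flow starts at the datum. [cite: Tao2016AveragedNS, §5.5 (5.5)] -/
theorem delayFlowSeed_zero (K M ε ν : ℝ) (p : Fin 5 → ℝ) : delayFlowSeed K M ε ν 0 p = p :=
  (delayCircuitSeed_exists_solution_from K M ε ν p).choose_spec.1

/-- The flow solves the reduced-seed member's ODE for all times. [cite: Tao2016AveragedNS, §5.5 (5.5)] -/
theorem hasDerivAt_delayFlowSeed (K M ε ν : ℝ) (p : Fin 5 → ℝ) (σ : ℝ) :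
    HasDerivAt (fun σ' => delayFlowSeed K M ε ν σ' p)
      (delayCircuitSeed K M ε ν (delayFlowSeed K M ε ν σ p)) σ :=
  (delayCircuitSeed_exists_solution_from K M ε ν p).choose_spec.2 σ

/-- Uniqueness: a global trajectory of the reduced-seed member IS the flow line of its initial state.
[cite: Tao2016AveragedNS, §5.5 (5.5)] -/
theorem delayFlowSeed_eq_of_hasDerivAt {K M ε ν : ℝ} {X : ℝ → Fin 5 → ℝ}
    (hX : ∀ t, HasDerivAt X (delayCircuitSeed K M ε ν (X t)) t) :
    (fun σ => delayFlowSeed K M ε ν σ (X 0)) = X :=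
  delayCircuitSeed_solution_unique K M ε ν (hasDerivAt_delayFlowSeed K M ε ν (X 0)) hX
    (delayFlowSeed_zero K M ε ν _)

/-- At `ν = 0` the reduced-seed flow is the member's flow `delayFlowWith`. [cite: Tao2016AveragedNS, §5.5 (5.5)] -/
theorem delayFlowSeed_zero_eq (K M ε : ℝ) : delayFlowSeed K M ε 0 = delayFlowWith K M ε := by
  funext σ p
  have h := delayFlowSeed_eq_of_hasDerivAt (K := K) (M := M) (ε := ε) (ν := 0)
    (X := fun σ' => delayFlowWith K M ε σ' p) (fun t => by
      simpa [delayCircuitSeed_zero] using hasDerivAt_delayFlowWith K M ε p t)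
  have := congrFun h σ
  simpa [delayFlowWith_zero] using this

/-- Energy is conserved along the flow. [cite: Tao2016AveragedNS, §5.5 (energy-con)] -/
theorem energy_delayFlowSeed (K M ε ν : ℝ) (p : Fin 5 → ℝ) (σ : ℝ) :
    energy (delayFlowSeed K M ε ν σ p) = energy p := by
  have h := delayCircuitSeed_energy (hasDerivAt_delayFlowSeed K M ε ν p) σ 0
  rwa [delayFlowSeed_zero] at h

/-- The flow line stays in the sup-ball of radius `√(energy p)`. [cite: Tao2016AveragedNS, §5.5 (energy-con)] -/
theorem norm_delayFlowSeed_le (K M ε ν : ℝ) (p : Fin 5 → ℝ) (σ : ℝ) :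
    ‖delayFlowSeed K M ε ν σ p‖ ≤ Real.sqrt (energy p) := by
  simpa [energy_delayFlowSeed] using norm_le_sqrt_energy (delayFlowSeed K M ε ν σ p)

/-- Flow lines are continuous. [folklore] -/
theorem continuous_delayFlowSeed (K M ε ν : ℝ) (p : Fin 5 → ℝ) :
    Continuous fun σ => delayFlowSeed K M ε ν σ p :=
  continuous_iff_continuousAt.2 fun σ => (hasDerivAt_delayFlowSeed K M ε ν p σ).continuousAt

/-- `∂ₜ(d² + ã²) = 2ε⁻²c·a·d` along the reduced-seed member (the rotor and the drain are untouched).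
[cite: Tao2016AveragedNS, §5.5 (5.5)] -/
theorem delayCircuitSeed_out_energy {K M ε ν : ℝ} {X : ℝ → Fin 5 → ℝ} {t : ℝ}
    (hX : HasDerivAt X (delayCircuitSeed K M ε ν (X t)) t) :
    HasDerivAt (fun s => X s 3 ^ 2 + X s 4 ^ 2)
      (2 * (ε ^ 2)⁻¹ * X t 2 * X t 0 * X t 3) t := by
  refine (((hasDerivAt_pi.1 hX 3).fun_pow 2).fun_add ((hasDerivAt_pi.1 hX 4).fun_pow 2)).congr_deriv ?_
  simp only [show (2 : ℕ) - 1 = 1 from rfl, pow_one, Nat.cast_ofNat, delayCircuitSeed, Fin.isValue,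
    Matrix.cons_val]
  ring

/-- (c-eq) of the reduced-seed member: `∂ₜc = ε²e^{-M}e^{-ν²}a² + ε⁻¹Mbc`. [cite: Tao2016AveragedNS, §5.5 (5.5)] -/
theorem Thm53With.hasDerivAt_cS {K M ε ν : ℝ} {X : ℝ → Fin 5 → ℝ}
    (hX : ∀ t, HasDerivAt X (delayCircuitSeed K M ε ν (X t)) t) (t : ℝ) :
    HasDerivAt (fun s => X s 2)
      (ε ^ 2 * exp (-M) * exp (-ν ^ 2) * X t 0 ^ 2 + ε⁻¹ * M * X t 1 * X t 2) t :=
  (hasDerivAt_pi.1 (hX t) 2).congr_deriv (by simp [delayCircuitSeed])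

section Ported

variable {K M ε ν κ : ℝ} {X : ℝ → Fin 5 → ℝ}

/-! ## §2. A-priori bounds on a kicked trajectory of the reduced-seed member

Verbatim ports (suffix `S`) of the a-priori lemmas of `NegativeKick.lean` §1–§2 for a
trajectory `X` of `delayCircuitSeed K M ε ν` issued from `kickInit (-κ)`: energy, signs,
the discounted trigger `c·e^{-G}` (`G = ∫ ε⁻¹M b`), the clock gap, the trapping
`-3ε²e^{-M} ≤ c ≤ 0` while the discounted drive has not overtaken the pre-load, and the
output bounds `|d|, |ã| ≤ 6e^{-M}` on `[0,2]`. Only the seed coupling changes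
(`ε²e^{-M} ↦ ε²e^{-M}e^{-ν²} ≤ ε²e^{-M}`), so every majorant survives. -/

/-- The (b), (c), (d) component equations of a trajectory of `delayCircuitSeed K M ε ν`, bundled
(the unbundled forms live in `RetunedTransition.lean`, which this file deliberately does not
import). [cite: Tao2016AveragedNS, §5.5 (5.5)] -/
theorem KickW.hasDerivAt_bcdS (hX : ∀ t, HasDerivAt X (delayCircuitSeed K M ε ν (X t)) t) (t : ℝ) :
    HasDerivAt (fun s => X s 1) (ε * X t 0 ^ 2 - ε⁻¹ * M * X t 2 ^ 2) t ∧
    HasDerivAt (fun s => X s 2) (ε ^ 2 * exp (-M) * exp (-ν ^ 2) * X t 0 ^ 2 + ε⁻¹ * M * X t 1 * X t 2) t ∧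
    HasDerivAt (fun s => X s 3) ((ε ^ 2)⁻¹ * X t 2 * X t 0 - K * X t 3 * X t 4) t :=
  ⟨(hasDerivAt_pi.1 (hX t) 1).congr_deriv (by simp [delayCircuitSeed]),
   (hasDerivAt_pi.1 (hX t) 2).congr_deriv (by simp [delayCircuitSeed]),
   (hasDerivAt_pi.1 (hX t) 3).congr_deriv (by simp [delayCircuitSeed])⟩

/-- Energy conservation along a kicked trajectory of the family.
[cite: Tao2016AveragedNS, §5.5 (energy-con)] -/
theorem kickW_energyS (hX : ∀ t, HasDerivAt X (delayCircuitSeed K M ε ν (X t)) t)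
    (h0 : X 0 = kickInit κ) (hκ : κ ^ 2 ≤ 1) (t : ℝ) : energy (X t) = 1 := by
  rw [delayCircuitSeed_energy hX t 0, h0, energy_kickInit hκ]

/-- Each mode of a kicked trajectory of the family has square at most one.
[cite: Tao2016AveragedNS, §5.5] -/
theorem kickW_sq_le_oneS (hX : ∀ t, HasDerivAt X (delayCircuitSeed K M ε ν (X t)) t)
    (h0 : X 0 = kickInit κ) (hκ : κ ^ 2 ≤ 1) (t : ℝ) (i : Fin 5) : X t i ^ 2 ≤ 1 := by
  have h := kickW_energyS hX h0 hκ t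
  rw [energy] at h
  rw [← h]
  exact Finset.single_le_sum (f := fun j => X t j ^ 2) (fun j _ => sq_nonneg _) (Finset.mem_univ i)

/-- The pump variable obeys `b(t) ≤ εt` for `t ≥ 0` (`∂ₜb = εa² - ε⁻¹Mc² ≤ ε`, `M ≥ 0`).
[cite: Tao2016AveragedNS, §5.5 (5.5) b-equation] -/
theorem kickW_b_leS (hX : ∀ t, HasDerivAt X (delayCircuitSeed K M ε ν (X t)) t) (h0 : X 0 = kickInit κ)
    (hκ : κ ^ 2 ≤ 1) (hM : 0 ≤ M) (hε : 0 ≤ ε) {t : ℝ} (ht : 0 ≤ t) : X t 1 ≤ ε * t := by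
  have hanti := Thm53.antitoneOn_sub_of_deriv_le (convex_Ici 0)
    (fun s _ => (KickW.hasDerivAt_bcdS hX s).1) (fun s _ => (hasDerivAt_id s).const_mul ε)
    (fun s _ => by
      have ha : X s 0 ^ 2 ≤ 1 := kickW_sq_le_oneS hX h0 hκ s 0
      have h1 : ε * X s 0 ^ 2 ≤ ε := by simpa using mul_le_mul_of_nonneg_left ha hε
      have h2 : 0 ≤ ε⁻¹ * M * X s 2 ^ 2 := by
        have : 0 ≤ ε⁻¹ := inv_nonneg.2 hε
        positivity
      simpa using (show ε * X s 0 ^ 2 - ε⁻¹ * M * X s 2 ^ 2 ≤ ε by linarith))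
  have hmono := hanti (self_mem_Ici (a := (0 : ℝ))) (mem_Ici.2 ht) ht
  simp only [kick_init_b h0, id, mul_zero, sub_zero] at hmono
  linarith

/-- **The trigger stays non-negative** (indeed `c(t) ≥ κ·exp(∫₀ᵗ ε⁻¹Mb) > 0`): integrating
factor `exp(-∫₀ᵗ ε⁻¹Mb)`, as in the proof of Theorem 5.3. [cite: Tao2016AveragedNS, §5.5 proof] -/
theorem kickW_c_nonnegS (hX : ∀ t, HasDerivAt X (delayCircuitSeed K M ε ν (X t)) t) (h0 : X 0 = kickInit κ)
    (hκ0 : 0 ≤ κ) {t : ℝ} (ht : 0 ≤ t) : 0 ≤ X t 2 := by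
  set G : ℝ → ℝ := fun s => ∫ r in (0 : ℝ)..s, ε⁻¹ * M * X r 1 with hG
  have hGd : ∀ s, HasDerivAt G (ε⁻¹ * M * X s 1) s := fun s =>
    ((continuous_const.mul ((continuous_apply 1).comp (continuous_iff_continuousAt.2 fun t => (hX t).continuousAt))).integral_hasStrictDerivAt 0 s).hasDerivAt
  have hmono := Thm53.monotoneOn_intFactor (s := univ) (φ := fun _ => 0) (Φ := fun _ => 0)
    convex_univ (fun s _ => (KickW.hasDerivAt_bcdS hX s).2.1) (fun s _ => hGd s)
    (fun s _ => hasDerivAt_const s (0 : ℝ))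
    (fun s _ => by
      have : (ε ^ 2 * exp (-M) * exp (-ν ^ 2) * X s 0 ^ 2 + ε⁻¹ * M * X s 1 * X s 2
          - ε⁻¹ * M * X s 1 * X s 2) * exp (-G s)
          = ε ^ 2 * exp (-M) * exp (-ν ^ 2) * X s 0 ^ 2 * exp (-G s) := by ring
      rw [this]; positivity)
  have h := hmono (mem_univ 0) (mem_univ t) ht
  have hG0 : G 0 = 0 := by simp [hG]
  simp only [kick_init_c h0, hG0, neg_zero, exp_zero, mul_one, sub_zero] at h
  exact (mul_nonneg_iff_of_pos_right (exp_pos (-G t))).1 (hκ0.trans h)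

namespace NegKick

/-- Trajectories are continuous, mode by mode. [folklore] -/
theorem continuous_trajS (hX : ∀ t, HasDerivAt X (delayCircuitSeed K M ε ν (X t)) t) (i : Fin 5) :
    Continuous fun t => X t i :=
  (continuous_apply i).comp (continuous_iff_continuousAt.2 fun t => (hX t).continuousAt)

/-- `G' = ε⁻¹M·b`. [cite: Tao2016AveragedNS, §5.5 (5.5)] -/
theorem hasDerivAt_clockIntS (hX : ∀ t, HasDerivAt X (delayCircuitSeed K M ε ν (X t)) t) (t : ℝ) :
    HasDerivAt (clockInt ε M X) (ε⁻¹ * M * X t 1) t := by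
  have hc : Continuous fun r => ε⁻¹ * M * X r 1 := continuous_const.mul (continuous_trajS hX 1)
  show HasDerivAt (fun u => ∫ r in (0 : ℝ)..u, ε⁻¹ * M * X r 1) (ε⁻¹ * M * X t 1) t
  exact (hc.integral_hasStrictDerivAt 0 t).hasDerivAt

/-- **The discounted trigger is driven by the seed only**:
`∂ₜ(c·e^{-G}) = ε²e^{-M}a²·e^{-G} ≥ 0`. [cite: Tao2016AveragedNS, §5.5 proof of Theorem 5.3] -/
theorem hasDerivAt_discS (hX : ∀ t, HasDerivAt X (delayCircuitSeed K M ε ν (X t)) t) (t : ℝ) :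
    HasDerivAt (fun s => X s 2 * exp (-clockInt ε M X s))
      (ε ^ 2 * exp (-M) * exp (-ν ^ 2) * X t 0 ^ 2 * exp (-clockInt ε M X t)) t := by
  refine ((Thm53With.hasDerivAt_cS hX t).fun_mul (hasDerivAt_clockIntS hX t).fun_neg.exp).congr_deriv ?_
  ring

/-- The discounted drive is non-negative. [cite: Tao2016AveragedNS, §5.5 (5.5)] -/
theorem disc_deriv_nonnegS (X : ℝ → Fin 5 → ℝ) (t : ℝ) :
    0 ≤ ε ^ 2 * exp (-M) * exp (-ν ^ 2) * X t 0 ^ 2 * exp (-clockInt ε M X t) := by positivity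

/-- The discounted trigger `c·e^{-G}` is non-decreasing along every trajectory of every member.
[cite: Tao2016AveragedNS, §5.5 proof of Theorem 5.3] -/
theorem disc_monotoneS (hX : ∀ t, HasDerivAt X (delayCircuitSeed K M ε ν (X t)) t) :
    Monotone fun s => X s 2 * exp (-clockInt ε M X s) := by
  refine monotone_of_deriv_nonneg (fun t => (hasDerivAt_discS hX t).differentiableAt) fun t => ?_
  rw [(hasDerivAt_discS hX t).deriv]
  exact disc_deriv_nonnegS X t

/-- The derivative of the discounted trigger is at most `ε²e^{-M}·e^{-G}` on an energy-one
trajectory (`a² ≤ 1`). [cite: Tao2016AveragedNS, §5.5] -/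
theorem disc_deriv_leS (hX : ∀ t, HasDerivAt X (delayCircuitSeed K M ε ν (X t)) t)
    (h0 : X 0 = kickInit κ) (hκ : κ ^ 2 ≤ 1) (t : ℝ) :
    ε ^ 2 * exp (-M) * exp (-ν ^ 2) * X t 0 ^ 2 * exp (-clockInt ε M X t) ≤
      ε ^ 2 * exp (-M) * exp (-clockInt ε M X t) := by
  have ha : X t 0 ^ 2 ≤ 1 := kickW_sq_le_oneS hX h0 hκ t 0
  have hν : exp (-ν ^ 2) ≤ 1 := by rw [exp_le_one_iff]; nlinarith [sq_nonneg ν]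
  have h1 : 0 ≤ ε ^ 2 * exp (-M) * exp (-clockInt ε M X t) := by positivity
  have h2 : exp (-ν ^ 2) * X t 0 ^ 2 ≤ 1 := by nlinarith [sq_nonneg (X t 0), exp_pos (-ν ^ 2)]
  calc ε ^ 2 * exp (-M) * exp (-ν ^ 2) * X t 0 ^ 2 * exp (-clockInt ε M X t)
      = (exp (-ν ^ 2) * X t 0 ^ 2) * (ε ^ 2 * exp (-M) * exp (-clockInt ε M X t)) := by ring
    _ ≤ 1 * (ε ^ 2 * exp (-M) * exp (-clockInt ε M X t)) := mul_le_mul_of_nonneg_right h2 h1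
    _ = ε ^ 2 * exp (-M) * exp (-clockInt ε M X t) := by ring

/-- The derivative of the discounted trigger is at most the REDUCED seed `ε²e^{-M}e^{-ν²}·e^{-G}` on an
energy-one trajectory (`a² ≤ 1`). [cite: Tao2016AveragedNS, §5.5] -/
theorem disc_deriv_le_seedS (hX : ∀ t, HasDerivAt X (delayCircuitSeed K M ε ν (X t)) t)
    (h0 : X 0 = kickInit κ) (hκ : κ ^ 2 ≤ 1) (t : ℝ) :
    ε ^ 2 * exp (-M) * exp (-ν ^ 2) * X t 0 ^ 2 * exp (-clockInt ε M X t) ≤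
      ε ^ 2 * exp (-M) * exp (-ν ^ 2) * exp (-clockInt ε M X t) := by
  have ha : X t 0 ^ 2 ≤ 1 := kickW_sq_le_oneS hX h0 hκ t 0
  have h1 : 0 ≤ ε ^ 2 * exp (-M) * exp (-ν ^ 2) * exp (-clockInt ε M X t) := by positivity
  nlinarith

/-- The clock runs at most like `Mt`: `t ↦ G(t) - Mt²/2` is non-increasing on `t ≥ 0`
(`b ≤ εt`, `kickW_b_leS`). [cite: Tao2016AveragedNS, §5.5 (5.5) b-equation] -/
theorem clockGap_antitoneOnS (hX : ∀ t, HasDerivAt X (delayCircuitSeed K M ε ν (X t)) t)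
    (h0 : X 0 = kickInit κ) (hκ : κ ^ 2 ≤ 1) (hM : 0 ≤ M) (hε : 0 < ε) :
    AntitoneOn (fun t => clockInt ε M X t - M * t ^ 2 / 2) (Ici 0) := by
  refine Thm53.antitoneOn_sub_of_deriv_le (φ := fun t => M * t) (convex_Ici 0)
    (fun t _ => hasDerivAt_clockIntS hX t)
    (fun t _ => by
      have := ((hasDerivAt_id t).pow 2).const_mul M |>.div_const 2
      refine this.congr_deriv ?_
      simp; ring)
    fun t ht => ?_
  have hb : X t 1 ≤ ε * t := kickW_b_leS hX h0 hκ hM hε.le ht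
  calc ε⁻¹ * M * X t 1 = ε⁻¹ * M * X t 1 := rfl
    _ ≤ ε⁻¹ * M * (ε * t) := mul_le_mul_of_nonneg_left hb (by positivity)
    _ = M * t := by field_simp

/-- `G(t) ≤ Mt²/2` for `t ≥ 0`. [cite: Tao2016AveragedNS, §5.5] -/
theorem clockInt_leS (hX : ∀ t, HasDerivAt X (delayCircuitSeed K M ε ν (X t)) t)
    (h0 : X 0 = kickInit κ) (hκ : κ ^ 2 ≤ 1) (hM : 0 ≤ M) (hε : 0 < ε) {t : ℝ} (ht : 0 ≤ t) :
    clockInt ε M X t ≤ M * t ^ 2 / 2 := by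
  have h := clockGap_antitoneOnS hX h0 hκ hM hε (self_mem_Ici (a := (0 : ℝ))) (mem_Ici.2 ht) ht
  simp only [clockInt_zero] at h
  linarith

/-- For `0 ≤ u ≤ t`: `G(t) - G(u) ≤ M(t² - u²)/2`. [cite: Tao2016AveragedNS, §5.5] -/
theorem clockInt_sub_leS (hX : ∀ t, HasDerivAt X (delayCircuitSeed K M ε ν (X t)) t)
    (h0 : X 0 = kickInit κ) (hκ : κ ^ 2 ≤ 1) (hM : 0 ≤ M) (hε : 0 < ε) {u t : ℝ} (hu : 0 ≤ u)
    (hut : u ≤ t) : clockInt ε M X t - clockInt ε M X u ≤ M * t ^ 2 / 2 - M * u ^ 2 / 2 := by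
  have h := clockGap_antitoneOnS hX h0 hκ hM hε (mem_Ici.2 hu) (mem_Ici.2 (hu.trans hut)) hut
  simp only at h
  linarith

/-- **Lower a-priori bound**: `c(t) ≥ c(0)·e^{G(t)}`, hence for a NEGATIVE pre-load `c(0) = κ ≤ 0`:
`c(t) ≥ κ·e^{Mt²/2}` (`t ≥ 0`). [cite: Tao2016AveragedNS, §5.5 proof of Theorem 5.3] -/
theorem c_lowerS (hX : ∀ t, HasDerivAt X (delayCircuitSeed K M ε ν (X t)) t)
    (h0 : X 0 = kickInit κ) (hκ : κ ^ 2 ≤ 1) (hκ0 : κ ≤ 0) (hM : 0 ≤ M) (hε : 0 < ε) {t : ℝ}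
    (ht : 0 ≤ t) : κ * exp (M * t ^ 2 / 2) ≤ X t 2 := by
  have hmono := disc_monotoneS hX ht
  simp only [clockInt_zero, neg_zero, exp_zero, mul_one, kick_init_c h0] at hmono
  -- hmono : κ ≤ X t 2 * exp (-G t)
  have hG : clockInt ε M X t ≤ M * t ^ 2 / 2 := clockInt_leS hX h0 hκ hM hε ht
  have hpos : 0 < exp (-clockInt ε M X t) := exp_pos _
  have h1 : κ * exp (clockInt ε M X t) ≤ X t 2 := by
    have := mul_le_mul_of_nonneg_right hmono (exp_pos (clockInt ε M X t)).le
    rwa [mul_assoc, ← exp_add, neg_add_cancel, exp_zero, mul_one] at this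
  have h2 : κ * exp (M * t ^ 2 / 2) ≤ κ * exp (clockInt ε M X t) :=
    mul_le_mul_of_nonpos_left (exp_le_exp.2 hG) hκ0
  exact h2.trans h1

/-- **Upper a-priori bound**: `c(t) ≤ c(0)e^{G(t)} + ε²e^{-M}·t·e^{Mt²/2}`, hence for `κ ≤ 0`:
`c(t) ≤ ε²e^{-M}t·e^{Mt²/2}` (`t ≥ 0`): on `[0,t]` the discounted drive is at most
`ε²e^{-M}e^{-G(u)} ≤ ε²e^{-M}e^{-G(t) + Mt²/2}`. [cite: Tao2016AveragedNS, §5.5] -/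
theorem c_upperS (hX : ∀ t, HasDerivAt X (delayCircuitSeed K M ε ν (X t)) t)
    (h0 : X 0 = kickInit κ) (hκ : κ ^ 2 ≤ 1) (hκ0 : κ ≤ 0) (hM : 0 ≤ M) (hε : 0 < ε) {t : ℝ}
    (ht : 0 ≤ t) : X t 2 ≤ ε ^ 2 * exp (-M) * t * exp (M * t ^ 2 / 2) := by
  set k : ℝ := ε ^ 2 * exp (-M) * exp (-clockInt ε M X t + M * t ^ 2 / 2) with hk
  have hanti := Thm53.antitoneOn_sub_of_deriv_le (s := Icc 0 t)
    (f := fun s => X s 2 * exp (-clockInt ε M X s)) (φ := fun _ => k) (Φ := fun u => k * u)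
    (convex_Icc 0 t) (fun u _ => hasDerivAt_discS hX u)
    (fun u _ => by simpa using (hasDerivAt_id u).const_mul k) (fun u hu => by
      have h1 := disc_deriv_leS hX h0 hκ u
      have hG : clockInt ε M X t - clockInt ε M X u ≤ M * t ^ 2 / 2 - M * u ^ 2 / 2 :=
        clockInt_sub_leS hX h0 hκ hM hε hu.1 hu.2
      have h2 : exp (-clockInt ε M X u) ≤ exp (-clockInt ε M X t + M * t ^ 2 / 2) := by
        apply exp_le_exp.2
        nlinarith [sq_nonneg u]
      calc ε ^ 2 * exp (-M) * exp (-ν ^ 2) * X u 0 ^ 2 * exp (-clockInt ε M X u)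
          ≤ ε ^ 2 * exp (-M) * exp (-clockInt ε M X u) := h1
        _ ≤ k := by rw [hk]; exact mul_le_mul_of_nonneg_left h2 (by positivity))
  have h := hanti (left_mem_Icc.2 ht) (right_mem_Icc.2 ht) ht
  simp only [clockInt_zero, neg_zero, exp_zero, mul_one, kick_init_c h0, mul_zero, sub_zero] at h
  -- h : X t 2 * exp (-G t) - k * t ≤ κ
  have hpos : 0 < exp (clockInt ε M X t) := exp_pos _
  have h3 : X t 2 = (X t 2 * exp (-clockInt ε M X t)) * exp (clockInt ε M X t) := by
    rw [mul_assoc, ← exp_add]; simp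
  have h4 : X t 2 * exp (-clockInt ε M X t) ≤ κ + k * t := by linarith
  have h5 : X t 2 ≤ (κ + k * t) * exp (clockInt ε M X t) := by
    rw [h3]; exact mul_le_mul_of_nonneg_right h4 hpos.le
  have h6 : (κ + k * t) * exp (clockInt ε M X t) ≤ k * t * exp (clockInt ε M X t) := by
    apply mul_le_mul_of_nonneg_right _ hpos.le
    linarith
  have h7 : k * t * exp (clockInt ε M X t) = ε ^ 2 * exp (-M) * t * exp (M * t ^ 2 / 2) := by
    rw [hk]
    have : exp (-clockInt ε M X t + M * t ^ 2 / 2) * exp (clockInt ε M X t) = exp (M * t ^ 2 / 2) := by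
      rw [← exp_add]; congr 1; ring
    calc ε ^ 2 * exp (-M) * exp (-clockInt ε M X t + M * t ^ 2 / 2) * t * exp (clockInt ε M X t)
        = ε ^ 2 * exp (-M) * t * (exp (-clockInt ε M X t + M * t ^ 2 / 2) * exp (clockInt ε M X t)) := by ring
      _ = _ := by rw [this]
  linarith [h5, h6, h7.le, h7.ge]

/-- **The a-priori trigger bound on the cycle**: for a negative pre-load `κ ∈ [-1, 0]` and
`t ∈ [0,2]`, `|c(t)| ≤ (-κ + 2ε²e^{-M})·e^{2M}`. [cite: Tao2016AveragedNS, §5.5] -/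
theorem abs_c_leS (hX : ∀ t, HasDerivAt X (delayCircuitSeed K M ε ν (X t)) t)
    (h0 : X 0 = kickInit κ) (hκ : κ ^ 2 ≤ 1) (hκ0 : κ ≤ 0) (hM : 0 ≤ M) (hε : 0 < ε) {t : ℝ}
    (ht : t ∈ Icc (0 : ℝ) 2) : |X t 2| ≤ (-κ + 2 * (ε ^ 2 * exp (-M))) * exp (2 * M) := by
  have hl := c_lowerS hX h0 hκ hκ0 hM hε ht.1
  have hu := c_upperS hX h0 hκ hκ0 hM hε ht.1
  have he : exp (M * t ^ 2 / 2) ≤ exp (2 * M) := by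
    apply exp_le_exp.2
    have ht2 : t ^ 2 ≤ 4 := by nlinarith [ht.1, ht.2]
    have := mul_le_mul_of_nonneg_left ht2 hM
    linarith
  have he0 : 0 < exp (M * t ^ 2 / 2) := exp_pos _
  rw [abs_le]
  constructor
  · have : κ * exp (2 * M) ≤ κ * exp (M * t ^ 2 / 2) := mul_le_mul_of_nonpos_left he hκ0
    have h2 : 0 ≤ 2 * (ε ^ 2 * exp (-M)) * exp (2 * M) := by positivity
    nlinarith
  · have h1 : ε ^ 2 * exp (-M) * t * exp (M * t ^ 2 / 2) ≤ 2 * (ε ^ 2 * exp (-M)) * exp (2 * M) := by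
      have : ε ^ 2 * exp (-M) * t ≤ 2 * (ε ^ 2 * exp (-M)) := by nlinarith [ht.2, sq_nonneg ε, exp_pos (-M), mul_pos (pow_pos hε 2) (exp_pos (-M))]
      exact mul_le_mul this he he0.le (by positivity)
    have h2 : 0 ≤ -κ * exp (2 * M) := by nlinarith [exp_pos (2 * M)]
    nlinarith

/-- **The clock's floor**: if `|c| ≤ C` on `[0,τ]` then `b(t) ≥ -ε⁻¹MC²·t` there
(`∂ₜb = εa² - ε⁻¹Mc² ≥ -ε⁻¹MC²`). [cite: Tao2016AveragedNS, §5.5 (5.5) b-equation] -/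
theorem b_lowerS (hX : ∀ t, HasDerivAt X (delayCircuitSeed K M ε ν (X t)) t)
    (h0 : X 0 = kickInit κ) (hM : 0 ≤ M) (hε : 0 < ε) {C τ : ℝ}
    (hC : ∀ u ∈ Icc 0 τ, |X u 2| ≤ C) {t : ℝ} (ht : t ∈ Icc 0 τ) :
    -(ε⁻¹ * M * C ^ 2) * t ≤ X t 1 := by
  have hmono := Thm53.monotoneOn_sub_of_le_deriv (s := Icc 0 τ) (f := fun s => X s 1)
    (φ := fun _ => -(ε⁻¹ * M * C ^ 2)) (Φ := fun u => -(ε⁻¹ * M * C ^ 2) * u) (convex_Icc 0 τ)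
    (fun u _ => (KickW.hasDerivAt_bcdS hX u).1)
    (fun u _ => by simpa using (hasDerivAt_id u).const_mul (-(ε⁻¹ * M * C ^ 2)))
    (fun u hu => by
      have hc : X u 2 ^ 2 ≤ C ^ 2 := by
        have := hC u hu
        rw [← sq_abs]; exact pow_le_pow_left₀ (abs_nonneg _) this 2
      have h1 : 0 ≤ ε * X u 0 ^ 2 := by positivity
      have h2 : ε⁻¹ * M * X u 2 ^ 2 ≤ ε⁻¹ * M * C ^ 2 :=
        mul_le_mul_of_nonneg_left hc (by positivity)
      linarith)
  have h := hmono (left_mem_Icc.2 (ht.1.trans ht.2)) ht ht.1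
  simp only [kick_init_b h0, mul_zero, sub_zero] at h
  linarith

/-- If `b ≥ -β` on `[0,τ]` then `t ↦ G(t) + ε⁻¹Mβ·t` is non-decreasing there: the clock integral
loses at most `ε⁻¹Mβ` per unit time. [cite: Tao2016AveragedNS, §5.5 (5.5)] -/
theorem clockFloor_monotoneOnS (hX : ∀ t, HasDerivAt X (delayCircuitSeed K M ε ν (X t)) t)
    (hM : 0 ≤ M) (hε : 0 < ε) {β τ : ℝ} (hb : ∀ u ∈ Icc 0 τ, -β ≤ X u 1) :
    MonotoneOn (fun t => clockInt ε M X t + ε⁻¹ * M * β * t) (Icc 0 τ) := by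
  have h := Thm53.monotoneOn_sub_of_le_deriv (s := Icc 0 τ) (f := clockInt ε M X)
    (φ := fun _ => -(ε⁻¹ * M * β)) (Φ := fun u => -(ε⁻¹ * M * β) * u) (convex_Icc 0 τ)
    (fun u _ => hasDerivAt_clockIntS hX u)
    (fun u _ => by simpa using (hasDerivAt_id u).const_mul (-(ε⁻¹ * M * β)))
    (fun u hu => by
      have := hb u hu
      have h1 : ε⁻¹ * M * (-β) ≤ ε⁻¹ * M * X u 1 := mul_le_mul_of_nonneg_left this (by positivity)
      linarith)
  intro u hu v hv huv
  have := h hu hv huv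
  simp only at this
  linarith

/-- **Endpoint bound (crude)**: with `b ≥ -β` on `[0,2]`,
`c(2)·e^{-G(2)} ≤ c(0) + 2ε²e^{-M}·e^{2ε⁻¹Mβ}`. [cite: Tao2016AveragedNS, §5.5] -/
theorem disc_two_leS (hX : ∀ t, HasDerivAt X (delayCircuitSeed K M ε ν (X t)) t)
    (h0 : X 0 = kickInit κ) (hκ : κ ^ 2 ≤ 1) (hM : 0 ≤ M) (hε : 0 < ε) {β : ℝ}
    (hb : ∀ u ∈ Icc (0 : ℝ) 2, -β ≤ X u 1) :
    X 2 2 * exp (-clockInt ε M X 2) ≤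
      κ + 2 * (ε ^ 2 * exp (-M)) * exp (2 * (ε⁻¹ * M * β)) := by
  set k : ℝ := ε ^ 2 * exp (-M) * exp (2 * (ε⁻¹ * M * β)) with hk
  have hGmono := clockFloor_monotoneOnS hX hM hε hb
  have hanti := Thm53.antitoneOn_sub_of_deriv_le (s := Icc (0 : ℝ) 2)
    (f := fun s => X s 2 * exp (-clockInt ε M X s)) (φ := fun _ => k) (Φ := fun u => k * u)
    (convex_Icc 0 2) (fun u _ => hasDerivAt_discS hX u)
    (fun u _ => by simpa using (hasDerivAt_id u).const_mul k) (fun u hu => by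
      have h1 := disc_deriv_leS hX h0 hκ u
      have hG := hGmono (left_mem_Icc.2 (by norm_num : (0 : ℝ) ≤ 2)) hu hu.1
      simp only [clockInt_zero, mul_zero, add_zero] at hG
      -- hG : 0 ≤ G u + ε⁻¹ M β u
      have h2 : exp (-clockInt ε M X u) ≤ exp (2 * (ε⁻¹ * M * β)) := by
        apply exp_le_exp.2
        have hβ0 : 0 ≤ β := by
          have := hb 0 (left_mem_Icc.2 (by norm_num))
          rw [kick_init_b h0] at this
          linarith
        have hβ' : 0 ≤ ε⁻¹ * M * β := by positivity
        have : ε⁻¹ * M * β * u ≤ 2 * (ε⁻¹ * M * β) := by nlinarith [hu.2]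
        linarith
      calc ε ^ 2 * exp (-M) * exp (-ν ^ 2) * X u 0 ^ 2 * exp (-clockInt ε M X u)
          ≤ ε ^ 2 * exp (-M) * exp (-clockInt ε M X u) := h1
        _ ≤ k := by rw [hk]; exact mul_le_mul_of_nonneg_left h2 (by positivity))
  have h := hanti (left_mem_Icc.2 (by norm_num : (0 : ℝ) ≤ 2))
    (right_mem_Icc.2 (by norm_num : (0 : ℝ) ≤ 2)) (by norm_num)
  simp only [clockInt_zero, neg_zero, exp_zero, mul_one, kick_init_c h0, mul_zero, sub_zero] at h
  rw [hk] at h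
  linarith

/-- **The trap**: if `b ≥ -β` on `[0,2]` and the trigger returns to ZERO at the end of the cycle,
`c(2) = 0`, then on the whole cycle `-ε²e^{-M}(2 - t)e^{2ε⁻¹Mβ} ≤ c(t) ≤ 0`.
[cite: Tao2016AveragedNS, §5.5 proof of Theorem 5.3] -/
theorem c_trappedS (hX : ∀ t, HasDerivAt X (delayCircuitSeed K M ε ν (X t)) t)
    (h0 : X 0 = kickInit κ) (hκ : κ ^ 2 ≤ 1) (hM : 0 ≤ M) (hε : 0 < ε) {β : ℝ}
    (hb : ∀ u ∈ Icc (0 : ℝ) 2, -β ≤ X u 1) (h2 : X 2 2 = 0) {t : ℝ} (ht : t ∈ Icc (0 : ℝ) 2) :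
    -(ε ^ 2 * exp (-M) * (2 - t) * exp (2 * (ε⁻¹ * M * β))) ≤ X t 2 ∧ X t 2 ≤ 0 := by
  have hpos : 0 < exp (-clockInt ε M X t) := exp_pos _
  constructor
  · set k : ℝ := ε ^ 2 * exp (-M) * exp (2 * (ε⁻¹ * M * β) - clockInt ε M X t) with hk
    have hGmono := clockFloor_monotoneOnS hX hM hε hb
    have hanti := Thm53.antitoneOn_sub_of_deriv_le (s := Icc t 2)
      (f := fun s => X s 2 * exp (-clockInt ε M X s)) (φ := fun _ => k) (Φ := fun u => k * u)
      (convex_Icc t 2) (fun u _ => hasDerivAt_discS hX u)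
      (fun u _ => by simpa using (hasDerivAt_id u).const_mul k) (fun u hu => by
        have h1 := disc_deriv_leS hX h0 hκ u
        have hu' : u ∈ Icc (0 : ℝ) 2 := ⟨ht.1.trans hu.1, hu.2⟩
        have hG := hGmono ht hu' hu.1
        simp only at hG
        -- hG : G t + c t ≤ G u + c u
        have h2 : exp (-clockInt ε M X u) ≤ exp (2 * (ε⁻¹ * M * β) - clockInt ε M X t) := by
          apply exp_le_exp.2
          have hβ0 : 0 ≤ β := by
            have hb0 := hb 0 (left_mem_Icc.2 (by norm_num))
            rw [kick_init_b h0] at hb0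
            linarith
          have hβ' : 0 ≤ ε⁻¹ * M * β := by positivity
          have : ε⁻¹ * M * β * (u - t) ≤ 2 * (ε⁻¹ * M * β) := by nlinarith [hu.1, hu.2, ht.1]
          nlinarith
        calc ε ^ 2 * exp (-M) * exp (-ν ^ 2) * X u 0 ^ 2 * exp (-clockInt ε M X u)
            ≤ ε ^ 2 * exp (-M) * exp (-clockInt ε M X u) := h1
          _ ≤ k := by rw [hk]; exact mul_le_mul_of_nonneg_left h2 (by positivity))
    have h := hanti (left_mem_Icc.2 ht.2) (right_mem_Icc.2 ht.2) ht.2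
    simp only [h2, zero_mul, zero_sub] at h
    -- h : -(k * 2) ≤ X t 2 * exp (-G t) - k * t
    have h3 : -(k * (2 - t)) ≤ X t 2 * exp (-clockInt ε M X t) := by linarith
    have h4 : X t 2 = (X t 2 * exp (-clockInt ε M X t)) * exp (clockInt ε M X t) := by
      rw [mul_assoc, ← exp_add]; simp
    have h5 : -(k * (2 - t)) * exp (clockInt ε M X t) ≤ X t 2 := by
      rw [h4]; exact mul_le_mul_of_nonneg_right h3 (exp_pos _).le
    have h6 : k * exp (clockInt ε M X t) = ε ^ 2 * exp (-M) * exp (2 * (ε⁻¹ * M * β)) := by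
      rw [hk, mul_assoc, ← exp_add]; congr 1; ring_nf
    have h7 : -(k * (2 - t)) * exp (clockInt ε M X t)
        = -(ε ^ 2 * exp (-M) * (2 - t) * exp (2 * (ε⁻¹ * M * β))) := by
      have : -(k * (2 - t)) * exp (clockInt ε M X t) = -((k * exp (clockInt ε M X t)) * (2 - t)) := by
        ring
      rw [this, h6]; ring
    linarith [h5, h7.le, h7.ge]
  · have hmono := disc_monotoneS hX ht.2
    simp only [h2, zero_mul] at hmono
    -- hmono : X t 2 * exp (-G t) ≤ 0
    by_contra hlt
    have hlt' : 0 < X t 2 := lt_of_not_ge hlt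
    have := mul_pos hlt' hpos
    linarith

/-- **The output follows the trigger**: if `|c| ≤ C` on `[0,τ]` along a kicked trajectory
(`d(0) = ã(0) = 0`, `a² ≤ 1`) then `|d(t)|, |ã(t)| ≤ ε⁻²C·t` there — from
`∂ₜ(d² + ã²) = 2ε⁻²c·a·d` (`delayCircuitSeed_out_energy`) applied to `√(d² + ã² + μ²)`.
[cite: Tao2016AveragedNS, §5.5 (dora)] -/
theorem de_leS (hX : ∀ t, HasDerivAt X (delayCircuitSeed K M ε ν (X t)) t)
    (h0 : X 0 = kickInit κ) (hκ : κ ^ 2 ≤ 1) (hε : 0 < ε) {C τ : ℝ} (hC0 : 0 ≤ C)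
    (hC : ∀ u ∈ Icc 0 τ, |X u 2| ≤ C) {t : ℝ} (ht : t ∈ Icc 0 τ) :
    |X t 3| ≤ (ε ^ 2)⁻¹ * C * t ∧ |X t 4| ≤ (ε ^ 2)⁻¹ * C * t := by
  set u : ℝ → ℝ := fun s => X s 3 ^ 2 + X s 4 ^ 2 with hu
  suffices hmain : ∀ μ : ℝ, 0 < μ → Real.sqrt (u t + μ ^ 2) ≤ μ + (ε ^ 2)⁻¹ * C * t by
    have hd : ∀ μ : ℝ, 0 < μ → |X t 3| ≤ (ε ^ 2)⁻¹ * C * t + μ := fun μ hμ => by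
      have : |X t 3| ≤ Real.sqrt (u t + μ ^ 2) :=
        abs_le_sqrt (by simp only [hu]; nlinarith [sq_nonneg (X t 4)])
      linarith [hmain μ hμ]
    have he : ∀ μ : ℝ, 0 < μ → |X t 4| ≤ (ε ^ 2)⁻¹ * C * t + μ := fun μ hμ => by
      have : |X t 4| ≤ Real.sqrt (u t + μ ^ 2) :=
        abs_le_sqrt (by simp only [hu]; nlinarith [sq_nonneg (X t 3)])
      linarith [hmain μ hμ]
    exact ⟨le_of_forall_pos_le_add fun μ hμ => hd μ hμ,
      le_of_forall_pos_le_add fun μ hμ => he μ hμ⟩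
  intro μ hμ
  set h : ℝ → ℝ := fun s => Real.sqrt (u s + μ ^ 2) with hh
  have hupos : ∀ s, 0 < u s + μ ^ 2 := fun s => by positivity
  have hder : ∀ s, HasDerivAt h
      ((2 * (ε ^ 2)⁻¹ * X s 2 * X s 0 * X s 3) / (2 * Real.sqrt (u s + μ ^ 2))) s := fun s =>
    ((delayCircuitSeed_out_energy (hX s)).add_const (μ ^ 2)).sqrt (hupos s).ne'
  have hbound : ∀ s ∈ Icc 0 τ,
      (2 * (ε ^ 2)⁻¹ * X s 2 * X s 0 * X s 3) / (2 * Real.sqrt (u s + μ ^ 2)) ≤ (ε ^ 2)⁻¹ * C := by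
    intro s hs
    have hhpos : 0 < Real.sqrt (u s + μ ^ 2) := Real.sqrt_pos.2 (hupos s)
    rw [div_le_iff₀ (by positivity)]
    have hcs : |X s 2| ≤ C := hC s hs
    have ha : |X s 0| ≤ 1 := by
      have := kickW_sq_le_oneS hX h0 hκ s 0
      rw [← sq_abs] at this
      nlinarith [abs_nonneg (X s 0)]
    have hds : |X s 3| ≤ Real.sqrt (u s + μ ^ 2) :=
      abs_le_sqrt (by simp only [hu]; nlinarith [sq_nonneg (X s 4)])
    have h1 : |X s 2 * X s 0 * X s 3| ≤ C * Real.sqrt (u s + μ ^ 2) := by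
      rw [abs_mul, abs_mul]
      calc |X s 2| * |X s 0| * |X s 3| ≤ C * 1 * Real.sqrt (u s + μ ^ 2) :=
            mul_le_mul (mul_le_mul hcs ha (abs_nonneg _) hC0) hds (abs_nonneg _) (by positivity)
        _ = C * Real.sqrt (u s + μ ^ 2) := by ring
    have h2 : X s 2 * X s 0 * X s 3 ≤ C * Real.sqrt (u s + μ ^ 2) := (le_abs_self _).trans h1
    have h3 : 0 < (ε ^ 2)⁻¹ := by positivity
    have : 2 * (ε ^ 2)⁻¹ * X s 2 * X s 0 * X s 3 = 2 * (ε ^ 2)⁻¹ * (X s 2 * X s 0 * X s 3) := by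
      ring
    rw [this]
    nlinarith
  have hanti := Thm53.antitoneOn_sub_of_deriv_le (Φ := fun s => (ε ^ 2)⁻¹ * C * s)
    (convex_Icc 0 τ) (fun s _ => hder s)
    (fun s _ => ((hasDerivAt_id s).const_mul ((ε ^ 2)⁻¹ * C)).congr_deriv (by simp)) hbound
  have h0mem : (0 : ℝ) ∈ Icc (0 : ℝ) τ := ⟨le_rfl, ht.1.trans ht.2⟩
  have hmono := hanti h0mem ht ht.1
  have hh0 : h 0 = μ := by
    simp only [hh, hu, kick_init_d h0, kick_init_e h0]
    simp [Real.sqrt_sq hμ.le]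
  simp only [hh0, mul_zero, sub_zero] at hmono
  show h t ≤ μ + (ε ^ 2)⁻¹ * C * t
  linarith

end NegKick

/-! ## §3. The cycle-end trigger of the reduced-seed member and the dud by continuity

`cycleEndTriggerS K M ε ν κ = c(2)` along the exact flow from `kickInit (-κ)`; it is
continuous in `κ ∈ [0,1]`, non-negative at `κ = 0`, so a negative value at `κ₁ ≤ 3ε²e^{-M}`
yields a DUD pre-load `κ* ∈ [0, κ₁)` with `c(2) = 0`, `c ≤ 0` and `|d|, |ã| ≤ 6e^{-M}` on the
cycle (`exists_dud_of_cycleEndTrigger_negS`; the lower pin of `NegativeKickThreshold` is not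
ported — it is not needed for necessity). -/

open NegKick

/-- The cycle-end value `c(2)` of the member's flow line from the datum `kickInit(-κ)`.
[cite: Tao2016AveragedNS, §5.5 (5.5)–(5.6)] -/
noncomputable def cycleEndTriggerS (K M ε ν κ : ℝ) : ℝ :=
  delayFlowSeed K M ε ν 2 (kickInit (-κ)) 2

/-- Lipschitz dependence of the member's flow on an energy-at-most-one datum (Grönwall with the
explicit constant `delayLipschitzWith K M ε 1` on the unit sup-ball; both flow lines stay there by
energy conservation). [cite: HairerNorsettWanner1993, Thm I.10.2] -/
theorem norm_delayFlowWith_sub_leS (K M ε ν : ℝ) {p q : Fin 5 → ℝ} (hp : energy p ≤ 1)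
    (hq : energy q ≤ 1) {t : ℝ} (ht : 0 ≤ t) :
    ‖delayFlowSeed K M ε ν t p - delayFlowSeed K M ε ν t q‖ ≤
      ‖p - q‖ * exp (delayLipschitzWith K M ε 1 * t) := by
  have hP : IsPseudoOrbit (delayCircuitSeed K M ε ν) 0 1 t (fun s => delayFlowSeed K M ε ν s p) :=
    IsPseudoOrbit.of_hasDerivAt (hasDerivAt_delayFlowSeed K M ε ν p) fun s _ =>
      (norm_delayFlowSeed_le K M ε ν p s).trans (by
        simpa using Real.sqrt_le_sqrt hp)
  have hQ : IsPseudoOrbit (delayCircuitSeed K M ε ν) 0 1 t (fun s => delayFlowSeed K M ε ν s q) :=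
    IsPseudoOrbit.of_hasDerivAt (hasDerivAt_delayFlowSeed K M ε ν q) fun s _ =>
      (norm_delayFlowSeed_le K M ε ν q s).trans (by
        simpa using Real.sqrt_le_sqrt hq)
  have h := IsPseudoOrbit.norm_sub_le (lipschitzOnWith_delayCircuitSeed K M ε ν 1) hP hQ
    (δ₀ := ‖p - q‖) (by simp [delayFlowSeed_zero]) (right_mem_Icc.2 ht)
  simpa [gronwallBound_ε0] using h

/-- The cycle-end trigger is continuous in the pre-load on `[0,1]`. [cite: Tao2016AveragedNS, §5.5 Theorem 5.3] -/
theorem continuousOn_cycleEndTriggerS (K M ε ν : ℝ) :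
    ContinuousOn (cycleEndTriggerS K M ε ν) (Icc 0 1) := by
  rw [Metric.continuousOn_iff]
  intro κ hκ η hη
  set L : ℝ := exp (delayLipschitzWith K M ε 1 * 2) with hL
  have hL0 : 0 < L := exp_pos _
  obtain ⟨δ, hδ0, hδ⟩ := Metric.continuous_iff.1 continuous_kickInit_neg κ (η / L) (by positivity)
  refine ⟨δ, hδ0, fun κ' hκ' hdist => ?_⟩
  have he : ∀ x ∈ Icc (0 : ℝ) 1, energy (kickInit (-x)) ≤ 1 := fun x hx => by
    rw [energy_kickInit (by nlinarith [hx.1, hx.2])]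
  have h1 := norm_delayFlowWith_sub_leS K M ε ν (he κ' hκ') (he κ hκ) (t := 2) (by norm_num)
  have h2 : ‖kickInit (-κ') - kickInit (-κ)‖ < η / L := by
    have := hδ κ' hdist; rwa [dist_eq_norm] at this
  rw [dist_eq_norm]
  calc ‖cycleEndTriggerS K M ε ν κ' - cycleEndTriggerS K M ε ν κ‖
      ≤ ‖delayFlowSeed K M ε ν 2 (kickInit (-κ')) - delayFlowSeed K M ε ν 2 (kickInit (-κ))‖ := by
        simpa [cycleEndTriggerS] using norm_le_pi_norm
          (delayFlowSeed K M ε ν 2 (kickInit (-κ')) - delayFlowSeed K M ε ν 2 (kickInit (-κ))) 2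
    _ ≤ ‖kickInit (-κ') - kickInit (-κ)‖ * L := h1
    _ < η / L * L := mul_lt_mul_of_pos_right h2 hL0
    _ = η := by field_simp

/-- At zero pre-load (Tao's datum (5.6)) the cycle-end trigger is non-negative. [cite: Tao2016AveragedNS, §5.5] -/
theorem cycleEndTrigger_zero_nonnegS (K M ε ν : ℝ) : 0 ≤ cycleEndTriggerS K M ε ν 0 := by
  have h := kickW_c_nonnegS (K := K) (M := M) (ε := ε) (κ := 0)
    (X := fun s => delayFlowSeed K M ε ν s (kickInit 0)) (hasDerivAt_delayFlowSeed K M ε ν _)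
    (delayFlowSeed_zero K M ε ν _) le_rfl (t := 2) (by norm_num)
  simpa [cycleEndTriggerS] using h

/-- **Everything about one trajectory with pre-load in `[-3ε²e^{-M}, 0]`** under the standing
hypotheses: `|c| ≤ 5ε²e^{M}` and `b ≥ -50Mε³e^{2M}` on the cycle, and the cycle-end discounted
trigger is at most `-κ + (11/5)ε²e^{-M}`. [cite: Tao2016AveragedNS, §5.5] -/
theorem negKick_trajectoryS (hK : 2 * 20 ^ 42 * (Nat.factorial 42 : ℝ) + 16 ≤ K)
    (hML : 3000 * Real.log K ≤ M) (hMK : M ≤ K ^ 10) (hε : 0 < ε)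
    (hεle : ε ≤ exp (-(10 * M)) / K ^ 100) (hX : ∀ t, HasDerivAt X (delayCircuitSeed K M ε ν (X t)) t)
    (h0 : X 0 = kickInit (-κ)) (hκ0 : 0 ≤ κ) (hκ3 : κ ≤ 3 * (ε ^ 2 * exp (-M))) :
    (∀ t ∈ Icc (0 : ℝ) 2, |X t 2| ≤ 5 * (ε ^ 2 * exp (-M)) * exp (2 * M)) ∧
    (∀ t ∈ Icc (0 : ℝ) 2, -(50 * M * ε ^ 3 * exp (2 * M)) ≤ X t 1) ∧
    X 2 2 * exp (-clockInt ε M X 2) ≤ -κ + 11 / 5 * (ε ^ 2 * exp (-M)) := by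
  obtain ⟨hK16, hM4, hε1, hs3, hsmall, -⟩ := negKick_params hK hML hMK hε hεle
  have hM : 0 ≤ M := by linarith
  have hκsq : (-κ) ^ 2 ≤ 1 := by rw [neg_sq]; nlinarith
  have hκneg : -κ ≤ 0 := by linarith
  have hc : ∀ t ∈ Icc (0 : ℝ) 2, |X t 2| ≤ 5 * (ε ^ 2 * exp (-M)) * exp (2 * M) := fun t ht => by
    have := abs_c_leS hX h0 hκsq hκneg hM hε ht
    rw [neg_neg] at this
    refine this.trans ?_
    have : κ + 2 * (ε ^ 2 * exp (-M)) ≤ 5 * (ε ^ 2 * exp (-M)) := by linarith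
    exact mul_le_mul_of_nonneg_right this (exp_pos _).le
  have hb : ∀ t ∈ Icc (0 : ℝ) 2, -(50 * M * ε ^ 3 * exp (2 * M)) ≤ X t 1 := fun t ht => by
    have h := b_lowerS hX h0 hM hε hc ht
    have hC : ε⁻¹ * M * (5 * (ε ^ 2 * exp (-M)) * exp (2 * M)) ^ 2 = 25 * M * ε ^ 3 * exp (2 * M) := by
      have hE : (exp (-M) * exp (2 * M)) ^ 2 = exp (2 * M) := by
        rw [← exp_add, ← Real.exp_nat_mul]; congr 1; push_cast; ring
      have h' : (5 * (ε ^ 2 * exp (-M)) * exp (2 * M)) ^ 2 = 25 * ε ^ 4 * exp (2 * M) := by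
        rw [show 5 * (ε ^ 2 * exp (-M)) * exp (2 * M) = 5 * ε ^ 2 * (exp (-M) * exp (2 * M)) by ring,
          mul_pow, mul_pow, hE]; ring
      rw [h']; field_simp
    rw [hC] at h
    have : 0 ≤ 25 * M * ε ^ 3 * exp (2 * M) := by positivity
    nlinarith [ht.2]
  refine ⟨hc, hb, ?_⟩
  have h2 := disc_two_leS hX h0 hκsq hM hε (β := 50 * M * ε ^ 3 * exp (2 * M)) (fun u hu => hb u hu)
  have hf := floor_factor_le (M := M) hε hsmall
  have hpos : 0 ≤ 2 * (ε ^ 2 * exp (-M)) := by positivity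
  nlinarith

/-- **IVT step.** If the cycle-end trigger is negative at some pre-load `κ₁ ∈ [0, 3ε²e^{-M}]`, then
some pre-load `κ* ∈ (0, κ₁)` returns the trigger to zero exactly at the end of the cycle, and along
that EXACT flow line `-3ε²e^{-M} ≤ c ≤ 0` and `|d|, |ã| ≤ 6e^{-M}` on `[0,2]`.
[cite: Tao2016AveragedNS, Theorem 5.3] -/
theorem exists_dud_of_cycleEndTrigger_negS (hK : 2 * 20 ^ 42 * (Nat.factorial 42 : ℝ) + 16 ≤ K)
    (hML : 3000 * Real.log K ≤ M) (hMK : M ≤ K ^ 10) (hε : 0 < ε)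
    (hεle : ε ≤ exp (-(10 * M)) / K ^ 100) {κ₁ : ℝ} (hκ₁0 : 0 ≤ κ₁)
    (hκ₁ : κ₁ ≤ 3 * (ε ^ 2 * exp (-M))) (hneg : cycleEndTriggerS K M ε ν κ₁ < 0) :
    ∃ κ : ℝ, 0 ≤ κ ∧ κ < κ₁ ∧
      delayFlowSeed K M ε ν 2 (kickInit (-κ)) 2 = 0 ∧
      ∀ t ∈ Icc (0 : ℝ) 2,
        delayFlowSeed K M ε ν t (kickInit (-κ)) 2 ≤ 0 ∧
        -(3 * (ε ^ 2 * exp (-M))) ≤ delayFlowSeed K M ε ν t (kickInit (-κ)) 2 ∧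
        |delayFlowSeed K M ε ν t (kickInit (-κ)) 3| ≤ 6 * exp (-M) ∧
        |delayFlowSeed K M ε ν t (kickInit (-κ)) 4| ≤ 6 * exp (-M) := by
  obtain ⟨hK16, hM4, hε1, hs3, hsmall, hexpM⟩ := negKick_params hK hML hMK hε hεle
  have hM : 0 ≤ M := by linarith
  have hs : 0 < ε ^ 2 * exp (-M) := by positivity
  set s₃ : ℝ := 3 * (ε ^ 2 * exp (-M)) with hs₃
  -- IVT on [0, κ₁]
  have hcont : ContinuousOn (cycleEndTriggerS K M ε ν) (Icc 0 κ₁) :=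
    (continuousOn_cycleEndTriggerS K M ε ν).mono (Icc_subset_Icc le_rfl (by linarith))
  have hIVT := intermediate_value_Icc' hκ₁0 hcont
  have h0 : 0 ≤ cycleEndTriggerS K M ε ν 0 := cycleEndTrigger_zero_nonnegS K M ε ν
  obtain ⟨κ, ⟨hκ0, hκκ₁⟩, hroot⟩ := hIVT ⟨hneg.le, h0⟩
  have hκ3 : κ ≤ s₃ := hκκ₁.trans hκ₁
  -- the trajectory at the root
  set X : ℝ → Fin 5 → ℝ := fun σ => delayFlowSeed K M ε ν σ (kickInit (-κ)) with hXdef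
  have hX : ∀ t, HasDerivAt X (delayCircuitSeed K M ε ν (X t)) t := hasDerivAt_delayFlowSeed K M ε ν _
  have hX0 : X 0 = kickInit (-κ) := delayFlowSeed_zero K M ε ν _
  have hκsq : (-κ) ^ 2 ≤ 1 := by rw [neg_sq]; nlinarith
  obtain ⟨hc5, hb, -⟩ := negKick_trajectoryS hK hML hMK hε hεle hX hX0 hκ0 hκ3
  have h2 : X 2 2 = 0 := by simpa [cycleEndTriggerS, hXdef] using hroot
  have hf := floor_factor_le (M := M) hε hsmall
  have htrap : ∀ t ∈ Icc (0 : ℝ) 2, X t 2 ≤ 0 ∧ -s₃ ≤ X t 2 := fun t ht => by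
    obtain ⟨hl, hu⟩ := c_trappedS hX hX0 hκsq hM hε (β := 50 * M * ε ^ 3 * exp (2 * M)) hb h2 ht
    refine ⟨hu, le_trans ?_ hl⟩
    have h22 : ε ^ 2 * exp (-M) * (2 - t) * exp (2 * (ε⁻¹ * M * (50 * M * ε ^ 3 * exp (2 * M))))
        ≤ ε ^ 2 * exp (-M) * 2 * (11 / 10) := by
      have ha : ε ^ 2 * exp (-M) * (2 - t) ≤ ε ^ 2 * exp (-M) * 2 := by nlinarith [ht.1]
      exact mul_le_mul ha hf (exp_pos _).le (by positivity)
    rw [hs₃]; linarith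
  have habs : ∀ t ∈ Icc (0 : ℝ) 2, |X t 2| ≤ s₃ := fun t ht => by
    obtain ⟨hu, hl⟩ := htrap t ht
    rw [abs_le]; exact ⟨hl, by linarith⟩
  have hde : ∀ t ∈ Icc (0 : ℝ) 2, |X t 3| ≤ 6 * exp (-M) ∧ |X t 4| ≤ 6 * exp (-M) := fun t ht => by
    obtain ⟨hd, he⟩ := de_leS hX hX0 hκsq hε (by positivity) habs ht
    have hC : (ε ^ 2)⁻¹ * s₃ * t ≤ 6 * exp (-M) := by
      have : (ε ^ 2)⁻¹ * s₃ = 3 * exp (-M) := by rw [hs₃]; field_simp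
      rw [this]; nlinarith [ht.2, exp_pos (-M)]
    exact ⟨hd.trans hC, he.trans hC⟩
  have hκlt : κ < κ₁ := by
    rcases hκκ₁.lt_or_eq with h | h
    · exact h
    · exfalso; rw [h] at hroot; linarith
  refine ⟨κ, hκ0, hκlt, h2, fun t ht => ⟨(htrap t ht).1, (htrap t ht).2, hde t ht⟩⟩

/-! ## §4. The fine Gaussian clock and the dud threshold `1.2535·ε²e^{-M}e^{-ν²}/√M`

Ports of `NegativeKickSharp` §1–§2 and `NegativeKickThreshold` §1–§2: along a kicked
trajectory the clock integral dominates `Mt²/2 - (lower order)`, so the discounted seed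
drive deposited over the cycle is at most `1.25349·ε²e^{-M}e^{-ν²}/√M`
(`negKick_trajectory_fineS`), and every pre-load `κ ≥ 1.2535·ε²e^{-M}e^{-ν²}/√M` (up to
`3ε²e^{-M}`) ends the cycle with a negative trigger (`cycleEndTrigger_neg_of_ge_fineS`). -/

namespace NegKick

/-- `|c(t)| ≤ (-κ + ε²e^{-M})e^{M/2}` on `[0,1]` for a pre-load `κ ≤ 0`. [cite: Tao2016AveragedNS, §5.5] -/
theorem abs_c_le_oneS (hX : ∀ t, HasDerivAt X (delayCircuitSeed K M ε ν (X t)) t)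
    (h0 : X 0 = kickInit κ) (hκ : κ ^ 2 ≤ 1) (hκ0 : κ ≤ 0) (hM : 0 ≤ M) (hε : 0 < ε) {t : ℝ}
    (ht : t ∈ Icc (0 : ℝ) 1) : |X t 2| ≤ (-κ + ε ^ 2 * exp (-M)) * exp (M / 2) := by
  have hl := c_lowerS hX h0 hκ hκ0 hM hε ht.1
  have hu := c_upperS hX h0 hκ hκ0 hM hε ht.1
  have he : exp (M * t ^ 2 / 2) ≤ exp (M / 2) := by
    apply exp_le_exp.2
    have ht2 : t ^ 2 ≤ 1 := by nlinarith [ht.1, ht.2]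
    have := mul_le_mul_of_nonneg_left ht2 hM
    linarith
  have he0 : 0 < exp (M * t ^ 2 / 2) := exp_pos _
  rw [abs_le]
  constructor
  · have : κ * exp (M / 2) ≤ κ * exp (M * t ^ 2 / 2) := mul_le_mul_of_nonpos_left he hκ0
    have h2 : 0 ≤ ε ^ 2 * exp (-M) * exp (M / 2) := by positivity
    nlinarith
  · have h1 : ε ^ 2 * exp (-M) * t * exp (M * t ^ 2 / 2) ≤ ε ^ 2 * exp (-M) * exp (M / 2) := by
      have : ε ^ 2 * exp (-M) * t ≤ ε ^ 2 * exp (-M) := by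
        nlinarith [ht.2, mul_pos (pow_pos hε 2) (exp_pos (-M))]
      exact mul_le_mul this he he0.le (by positivity)
    have h2 : 0 ≤ -κ * exp (M / 2) := by nlinarith [exp_pos (M / 2)]
    nlinarith

/-- The energy identity solved for `a²`. [cite: Tao2016AveragedNS, §5.5] -/
theorem a_sq_eqS (hX : ∀ t, HasDerivAt X (delayCircuitSeed K M ε ν (X t)) t)
    (h0 : X 0 = kickInit κ) (hκ : κ ^ 2 ≤ 1) (t : ℝ) :
    X t 0 ^ 2 = 1 - X t 1 ^ 2 - X t 2 ^ 2 - X t 3 ^ 2 - X t 4 ^ 2 := by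
  have h := kickW_energyS hX h0 hκ t
  rw [energy, Fin.sum_univ_five] at h
  linarith

/-- **The clock's linear floor on `[0,1]`**: if `a² ≥ 1 - η₁` and `ε⁻¹Mc² ≤ εη₂` on `[0,1]` then
`b(r) ≥ ε(1 - η₁ - η₂)r` there. [cite: Tao2016AveragedNS, §5.5 (5.5) b-equation] -/
theorem b_ge_linearS (hX : ∀ t, HasDerivAt X (delayCircuitSeed K M ε ν (X t)) t)
    (h0 : X 0 = kickInit κ) (hε : 0 < ε) {η₁ η₂ : ℝ}
    (ha : ∀ r ∈ Icc (0 : ℝ) 1, 1 - η₁ ≤ X r 0 ^ 2)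
    (hc : ∀ r ∈ Icc (0 : ℝ) 1, ε⁻¹ * M * X r 2 ^ 2 ≤ ε * η₂) {r : ℝ} (hr : r ∈ Icc (0 : ℝ) 1) :
    ε * (1 - η₁ - η₂) * r ≤ X r 1 := by
  have hmono := Thm53.monotoneOn_sub_of_le_deriv (s := Icc (0 : ℝ) 1) (f := fun s => X s 1)
    (φ := fun _ => ε * (1 - η₁ - η₂)) (Φ := fun u => ε * (1 - η₁ - η₂) * u) (convex_Icc 0 1)
    (fun u _ => (KickW.hasDerivAt_bcdS hX u).1)
    (fun u _ => by simpa using (hasDerivAt_id u).const_mul (ε * (1 - η₁ - η₂)))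
    (fun u hu => by
      have h1 := ha u hu
      have h2 := hc u hu
      have h3 : ε * (1 - η₁) ≤ ε * X u 0 ^ 2 := mul_le_mul_of_nonneg_left h1 hε.le
      linarith)
  have h := hmono (left_mem_Icc.2 zero_le_one) hr hr.1
  simp only [kick_init_b h0, mul_zero, sub_zero] at h
  linarith

/-- **The clock integral's quadratic floor on `[0,1]`**: if `b(r) ≥ ερr` on `[0,1]` then
`G(u) ≥ ρMu²/2` there. [cite: Tao2016AveragedNS, §5.5 (5.5)] -/
theorem clockInt_geS (hX : ∀ t, HasDerivAt X (delayCircuitSeed K M ε ν (X t)) t) (hM : 0 ≤ M)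
    (hε : 0 < ε) {ρ : ℝ} (hb : ∀ r ∈ Icc (0 : ℝ) 1, ε * ρ * r ≤ X r 1) {u : ℝ}
    (hu : u ∈ Icc (0 : ℝ) 1) : ρ * M * u ^ 2 / 2 ≤ clockInt ε M X u := by
  have hmono := Thm53.monotoneOn_sub_of_le_deriv (s := Icc (0 : ℝ) 1) (f := clockInt ε M X)
    (φ := fun r => ρ * M * r) (Φ := fun r => ρ * M * r ^ 2 / 2) (convex_Icc 0 1)
    (fun r _ => hasDerivAt_clockIntS hX r)
    (fun r _ => by
      have := ((hasDerivAt_id r).pow 2).const_mul (ρ * M) |>.div_const 2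
      refine this.congr_deriv ?_
      simp; ring)
    (fun r hr => by
      have h1 := mul_le_mul_of_nonneg_left (hb r hr) (show 0 ≤ ε⁻¹ * M by positivity)
      have : ε⁻¹ * M * (ε * ρ * r) = ρ * M * r := by field_simp
      linarith)
  have h := hmono (left_mem_Icc.2 zero_le_one) hu hu.1
  simp only [clockInt_zero] at h
  norm_num at h
  linarith

/-- **Sharp endpoint bound.** With `b ≥ -β` on `[0,2]` and `G(u) ≥ λu²` on `[0,1]` (`λ ≥ 0`):
`c(2)e^{-G(2)} ≤ c(0) + ε²e^{-M}(∫₀¹ e^{-λr²}dr + e^{2ε⁻¹Mβ - λ})` (any real `λ`).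
[cite: Tao2016AveragedNS, §5.5 proof of Theorem 5.3] -/
theorem disc_two_le_sharpS (hX : ∀ t, HasDerivAt X (delayCircuitSeed K M ε ν (X t)) t)
    (h0 : X 0 = kickInit κ) (hκ : κ ^ 2 ≤ 1) (hM : 0 ≤ M) (hε : 0 < ε) {β l : ℝ}
    (hb : ∀ u ∈ Icc (0 : ℝ) 2, -β ≤ X u 1)
    (hG : ∀ u ∈ Icc (0 : ℝ) 1, l * u ^ 2 ≤ clockInt ε M X u) :
    X 2 2 * exp (-clockInt ε M X 2) ≤
      κ + (ε ^ 2 * exp (-M) * exp (-ν ^ 2)) * (∫ r in (0 : ℝ)..1, exp (-l * r ^ 2)) +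
        (ε ^ 2 * exp (-M) * exp (-ν ^ 2)) * exp (2 * (ε⁻¹ * M * β) - l) := by
  set s : ℝ := (ε ^ 2 * exp (-M) * exp (-ν ^ 2)) with hs
  have hs0 : 0 ≤ s := by positivity
  have hβ0 : 0 ≤ β := by
    have := hb 0 (left_mem_Icc.2 (by norm_num))
    rw [kick_init_b h0] at this
    linarith
  have hβ' : 0 ≤ ε⁻¹ * M * β := by positivity
  -- piece 1: [0,1] against the Gaussian primitive
  have hcont : Continuous fun r : ℝ => exp (-l * r ^ 2) := by fun_prop
  have hanti1 := Thm53.antitoneOn_sub_of_deriv_le (s := Icc (0 : ℝ) 1)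
    (f := fun u => X u 2 * exp (-clockInt ε M X u)) (φ := fun u => s * exp (-l * u ^ 2))
    (Φ := fun u => s * ∫ r in (0 : ℝ)..u, exp (-l * r ^ 2)) (convex_Icc 0 1)
    (fun u _ => hasDerivAt_discS hX u)
    (fun u _ => ((hcont.integral_hasStrictDerivAt 0 u).hasDerivAt).const_mul s)
    (fun u hu => by
      have h1 := disc_deriv_le_seedS hX h0 hκ u
      have h2 : exp (-clockInt ε M X u) ≤ exp (-l * u ^ 2) :=
        exp_le_exp.2 (by have := hG u hu; linarith)
      calc (ε ^ 2 * exp (-M) * exp (-ν ^ 2)) * X u 0 ^ 2 * exp (-clockInt ε M X u)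
          ≤ (ε ^ 2 * exp (-M) * exp (-ν ^ 2)) * exp (-clockInt ε M X u) := h1
        _ ≤ s * exp (-l * u ^ 2) := by rw [hs]; exact mul_le_mul_of_nonneg_left h2 (by positivity))
  have hp1 := hanti1 (left_mem_Icc.2 zero_le_one) (right_mem_Icc.2 zero_le_one) zero_le_one
  simp only [clockInt_zero, neg_zero, exp_zero, mul_one, kick_init_c h0,
    intervalIntegral.integral_same, mul_zero, sub_zero] at hp1
  -- hp1 : X 1 2 * exp (-G 1) - s * ∫₀¹ ≤ κ
  -- piece 2: [1,2] at constant rate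
  set k : ℝ := s * exp (2 * (ε⁻¹ * M * β) - l) with hk
  have hGmono := clockFloor_monotoneOnS hX hM hε hb
  have hG1 : l ≤ clockInt ε M X 1 := by simpa using hG 1 (right_mem_Icc.2 zero_le_one)
  have hanti2 := Thm53.antitoneOn_sub_of_deriv_le (s := Icc (1 : ℝ) 2)
    (f := fun u => X u 2 * exp (-clockInt ε M X u)) (φ := fun _ => k) (Φ := fun u => k * u)
    (convex_Icc 1 2) (fun u _ => hasDerivAt_discS hX u)
    (fun u _ => by simpa using (hasDerivAt_id u).const_mul k) (fun u hu => by
      have h1 := disc_deriv_le_seedS hX h0 hκ u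
      have h1mem : (1 : ℝ) ∈ Icc (0 : ℝ) 2 := ⟨by norm_num, by norm_num⟩
      have humem : u ∈ Icc (0 : ℝ) 2 := ⟨by linarith [hu.1], hu.2⟩
      have hfl := hGmono h1mem humem hu.1
      simp only at hfl
      have h2 : exp (-clockInt ε M X u) ≤ exp (2 * (ε⁻¹ * M * β) - l) := by
        apply exp_le_exp.2
        have : ε⁻¹ * M * β * (u - 1) ≤ 2 * (ε⁻¹ * M * β) := by nlinarith [hu.1, hu.2]
        nlinarith
      calc (ε ^ 2 * exp (-M) * exp (-ν ^ 2)) * X u 0 ^ 2 * exp (-clockInt ε M X u)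
          ≤ (ε ^ 2 * exp (-M) * exp (-ν ^ 2)) * exp (-clockInt ε M X u) := h1
        _ ≤ k := by rw [hk, hs]; exact mul_le_mul_of_nonneg_left h2 (by positivity))
  have hp2 := hanti2 (left_mem_Icc.2 (by norm_num)) (right_mem_Icc.2 (by norm_num)) (by norm_num)
  simp only at hp2
  -- hp2 : X 2 2 * exp (-G 2) - k * 2 ≤ X 1 2 * exp (-G 1) - k * 1
  rw [hk] at hp2
  rw [hs] at hp1 hp2 ⊢
  linarith

end NegKick

namespace NegKick

/-- **A-priori bounds on `[0,1]`** for a pre-load in `[-3ε²e^{-M}, 0]` under the standing hypotheses: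
`a² ≥ 1 - (ε² + 48e^{-M})` (energy one; `|b| ≤ ε`, `|c| ≤ 4ε²e^{-M/2}`, `|d|, |ã| ≤ 4e^{-M/2}`) and
`ε⁻¹Mc² ≤ ε·16Mε²e^{-M}`. [cite: Tao2016AveragedNS, §5.5] -/
theorem unit_aprioriS (hK : 2 * 20 ^ 42 * (Nat.factorial 42 : ℝ) + 16 ≤ K)
    (hML : 3000 * Real.log K ≤ M) (hMK : M ≤ K ^ 10) (hε : 0 < ε)
    (hεle : ε ≤ exp (-(10 * M)) / K ^ 100) (hX : ∀ t, HasDerivAt X (delayCircuitSeed K M ε ν (X t)) t)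
    (h0 : X 0 = kickInit (-κ)) (hκ0 : 0 ≤ κ) (hκ3 : κ ≤ 3 * (ε ^ 2 * exp (-M))) :
    (∀ r ∈ Icc (0 : ℝ) 1, 1 - (ε ^ 2 + 48 * exp (-M)) ≤ X r 0 ^ 2) ∧
    (∀ r ∈ Icc (0 : ℝ) 1, ε⁻¹ * M * X r 2 ^ 2 ≤ ε * (16 * M * ε ^ 2 * exp (-M))) := by
  obtain ⟨hK16, hM4, hε1, hs3, hsmall, -⟩ := negKick_params hK hML hMK hε hεle
  obtain ⟨hM6000, hexpM, hε2, h16, hβε⟩ := negKick_params_sharp hK hML hMK hε hεle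
  have hM : 0 ≤ M := by linarith
  obtain ⟨s, hs⟩ : ∃ s : ℝ, s = ε ^ 2 * exp (-M) := ⟨_, rfl⟩
  have hs0 : 0 < s := by rw [hs]; positivity
  have hκsq : (-κ) ^ 2 ≤ 1 := by rw [neg_sq]; nlinarith
  have hκneg : -κ ≤ 0 := by linarith
  obtain ⟨-, hb, -⟩ := negKick_trajectoryS hK hML hMK hε hεle hX h0 hκ0 hκ3
  -- |c| ≤ 4 s e^{M/2} on [0,1]
  have hc1 : ∀ t ∈ Icc (0 : ℝ) 1, |X t 2| ≤ 4 * s * exp (M / 2) := fun t ht => by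
    have := abs_c_le_oneS hX h0 hκsq hκneg hM hε ht
    rw [neg_neg] at this
    refine this.trans ?_
    have : κ + ε ^ 2 * exp (-M) ≤ 4 * s := by rw [hs]; linarith
    exact mul_le_mul_of_nonneg_right this (exp_pos _).le
  -- |d|, |e| ≤ 4 e^{-M/2} on [0,1]
  have hde1 : ∀ t ∈ Icc (0 : ℝ) 1, |X t 3| ≤ 4 * exp (-(M / 2)) ∧ |X t 4| ≤ 4 * exp (-(M / 2)) :=
    fun t ht => by
    obtain ⟨hd, he⟩ := de_leS hX h0 hκsq hε (by positivity) hc1 ht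
    have hC : (ε ^ 2)⁻¹ * (4 * s * exp (M / 2)) * t ≤ 4 * exp (-(M / 2)) := by
      have h1 : (ε ^ 2)⁻¹ * (4 * s * exp (M / 2)) = 4 * exp (-(M / 2)) := by
        have hee : exp (-M) * exp (M / 2) = exp (-(M / 2)) := by rw [← exp_add]; ring_nf
        have hε2 : ε ^ 2 ≠ 0 := by positivity
        calc (ε ^ 2)⁻¹ * (4 * s * exp (M / 2)) = 4 * (exp (-M) * exp (M / 2)) := by
              rw [hs]; field_simp
          _ = 4 * exp (-(M / 2)) := by rw [hee]
      rw [h1]; nlinarith [ht.2, exp_pos (-(M / 2))]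
    exact ⟨hd.trans hC, he.trans hC⟩
  have hsqe : s ^ 2 * exp M ≤ exp (-M) := by
    have h1 : s ^ 2 * exp M = ε ^ 4 * exp (-M) := by
      have hee : exp (-M) * exp (-M) * exp M = exp (-M) := by rw [← exp_add, ← exp_add]; ring_nf
      rw [hs]
      calc (ε ^ 2 * exp (-M)) ^ 2 * exp M = ε ^ 4 * (exp (-M) * exp (-M) * exp M) := by ring
        _ = ε ^ 4 * exp (-M) := by rw [hee]
    rw [h1]
    have : ε ^ 4 ≤ 1 := by nlinarith [sq_nonneg ε]
    nlinarith [exp_pos (-M)]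
  have heM2 : exp (-(M / 2)) ^ 2 = exp (-M) := by rw [← Real.exp_nat_mul]; ring_nf
  have heM2' : exp (M / 2) ^ 2 = exp M := by rw [← Real.exp_nat_mul]; ring_nf
  refine ⟨fun r hr => ?_, fun r hr => ?_⟩
  · rw [a_sq_eqS hX h0 hκsq r]
    have hbu : X r 1 ≤ ε * r := kickW_b_leS hX h0 hκsq hM hε.le hr.1
    have hbl : -(50 * M * ε ^ 3 * exp (2 * M)) ≤ X r 1 := hb r ⟨hr.1, by linarith [hr.2]⟩
    have hb2 : X r 1 ^ 2 ≤ ε ^ 2 := by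
      have h1 : X r 1 ≤ ε := by nlinarith [hr.2]
      have h2 : -ε ≤ X r 1 := by linarith
      nlinarith
    have hc2 : X r 2 ^ 2 ≤ 16 * exp (-M) := by
      have h1 := hc1 r hr
      have h2 : X r 2 ^ 2 ≤ (4 * s * exp (M / 2)) ^ 2 := by
        rw [← sq_abs]; exact pow_le_pow_left₀ (abs_nonneg _) h1 2
      have h3 : (4 * s * exp (M / 2)) ^ 2 = 16 * (s ^ 2 * exp M) := by rw [← heM2']; ring
      rw [h3] at h2
      nlinarith
    obtain ⟨hd, he⟩ := hde1 r hr
    have hd2 : X r 3 ^ 2 ≤ 16 * exp (-M) := by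
      have : X r 3 ^ 2 ≤ (4 * exp (-(M / 2))) ^ 2 := by
        rw [← sq_abs]; exact pow_le_pow_left₀ (abs_nonneg _) hd 2
      rw [mul_pow, heM2] at this; linarith
    have he2 : X r 4 ^ 2 ≤ 16 * exp (-M) := by
      have : X r 4 ^ 2 ≤ (4 * exp (-(M / 2))) ^ 2 := by
        rw [← sq_abs]; exact pow_le_pow_left₀ (abs_nonneg _) he 2
      rw [mul_pow, heM2] at this; linarith
    linarith
  · have h1 := hc1 r hr
    have h2 : X r 2 ^ 2 ≤ (4 * s * exp (M / 2)) ^ 2 := by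
      rw [← sq_abs]; exact pow_le_pow_left₀ (abs_nonneg _) h1 2
    have h3 : (4 * s * exp (M / 2)) ^ 2 = 16 * ε ^ 4 * exp (-M) := by
      have : (4 * s * exp (M / 2)) ^ 2 = 16 * (s ^ 2 * exp M) := by rw [← heM2']; ring
      rw [this, hs]
      have hee : exp (-M) * exp (-M) * exp M = exp (-M) := by rw [← exp_add, ← exp_add]; ring_nf
      calc 16 * ((ε ^ 2 * exp (-M)) ^ 2 * exp M) = 16 * ε ^ 4 * (exp (-M) * exp (-M) * exp M) := by
            ring
        _ = 16 * ε ^ 4 * exp (-M) := by rw [hee]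
    rw [h3] at h2
    have h4 : ε⁻¹ * M * X r 2 ^ 2 ≤ ε⁻¹ * M * (16 * ε ^ 4 * exp (-M)) :=
      mul_le_mul_of_nonneg_left h2 (by positivity)
    have h5 : ε⁻¹ * M * (16 * ε ^ 4 * exp (-M)) = ε * (16 * M * ε ^ 2 * exp (-M)) := by
      field_simp
    linarith

/-- **The honest clock floor on `[0,1]`**: `G(u) ≥ ρMu²/2` with
`ρ = 1 - (ε² + 48e^{-M}) - 16Mε²e^{-M}` (`≥ 1 - 10⁻⁵`). [cite: Tao2016AveragedNS, §5.5] -/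
theorem clockInt_ge_unit_fineS (hK : 2 * 20 ^ 42 * (Nat.factorial 42 : ℝ) + 16 ≤ K)
    (hML : 3000 * Real.log K ≤ M) (hMK : M ≤ K ^ 10) (hε : 0 < ε)
    (hεle : ε ≤ exp (-(10 * M)) / K ^ 100) (hX : ∀ t, HasDerivAt X (delayCircuitSeed K M ε ν (X t)) t)
    (h0 : X 0 = kickInit (-κ)) (hκ0 : 0 ≤ κ) (hκ3 : κ ≤ 3 * (ε ^ 2 * exp (-M))) :
    ∀ u ∈ Icc (0 : ℝ) 1,
      (1 - (ε ^ 2 + 48 * exp (-M)) - 16 * M * ε ^ 2 * exp (-M)) * M * u ^ 2 / 2 ≤ clockInt ε M X u := by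
  obtain ⟨-, hM4, -⟩ := negKick_params hK hML hMK hε hεle
  have hM : 0 ≤ M := by linarith
  obtain ⟨ha, hcM⟩ := unit_aprioriS hK hML hMK hε hεle hX h0 hκ0 hκ3
  intro u hu
  exact clockInt_geS hX hM hε (fun r hr => b_ge_linearS hX h0 hε ha hcM hr) hu

/-- **The fine trajectory estimate.** For a pre-load in `[-3ε²e^{-M}, 0]` under the standing
hypotheses, the cycle-end discounted trigger is at most `-κ + 1.25349·ε²e^{-M}/√M`
(clock floor `ρ ≥ 1 - 10⁻⁵`, `√(2π)/2 ≤ 1.253315`, tail `≤ 10⁻⁵/√M`). [cite: Tao2016AveragedNS, §5.5] -/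
theorem negKick_trajectory_fineS (hK : 2 * 20 ^ 42 * (Nat.factorial 42 : ℝ) + 16 ≤ K)
    (hML : 3000 * Real.log K ≤ M) (hMK : M ≤ K ^ 10) (hε : 0 < ε)
    (hεle : ε ≤ exp (-(10 * M)) / K ^ 100) (hX : ∀ t, HasDerivAt X (delayCircuitSeed K M ε ν (X t)) t)
    (h0 : X 0 = kickInit (-κ)) (hκ0 : 0 ≤ κ) (hκ3 : κ ≤ 3 * (ε ^ 2 * exp (-M))) :
    X 2 2 * exp (-clockInt ε M X 2) ≤
      -κ + 125349 / 100000 * ((ε ^ 2 * exp (-M) * exp (-ν ^ 2))) / Real.sqrt M := by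
  obtain ⟨-, hM4, -, hs3, hsmall, -⟩ := negKick_params hK hML hMK hε hεle
  obtain ⟨hM6000, -⟩ := negKick_params_sharp hK hML hMK hε hεle
  obtain ⟨hε2M, hexp4, h4M, hMe⟩ := negKick_params_fine hK hML hMK hε hεle
  have hM : 0 ≤ M := by linarith
  have hM0 : 0 < M := by linarith
  have hκsq : (-κ) ^ 2 ≤ 1 := by rw [neg_sq]; nlinarith
  obtain ⟨-, hb, -⟩ := negKick_trajectoryS hK hML hMK hε hεle hX h0 hκ0 hκ3
  have hGl' := clockInt_ge_unit_fineS hK hML hMK hε hεle hX h0 hκ0 hκ3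
  obtain ⟨ρ, hρ⟩ : ∃ ρ : ℝ, ρ = 1 - (ε ^ 2 + 48 * exp (-M)) - 16 * M * ε ^ 2 * exp (-M) :=
    ⟨_, rfl⟩
  have hη2 : 16 * M * ε ^ 2 * exp (-M) ≤ 16 * exp (-M) := by
    have h1 : 16 * M * ε ^ 2 * exp (-M) = 16 * ε ^ 2 * (M * exp (-M)) := by ring
    have h2 : 16 * ε ^ 2 * (M * exp (-M)) ≤ 16 * ε ^ 2 * 1 :=
      mul_le_mul_of_nonneg_left hMe (by positivity)
    linarith
  have hρ1 : 99999 / 100000 ≤ ρ := by rw [hρ]; linarith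
  have hρ0 : 0 < ρ := by linarith
  have hl0 : 0 < ρ * M / 2 := by positivity
  have hGl : ∀ u ∈ Icc (0 : ℝ) 1, ρ * M / 2 * u ^ 2 ≤ clockInt ε M X u := fun u hu => by
    have := hGl' u hu
    rw [hρ]
    linarith
  have hsharp := disc_two_le_sharpS hX h0 hκsq hM hε hb hGl
  have hI : ∫ r in (0 : ℝ)..1, exp (-(ρ * M / 2) * r ^ 2) ≤ 125348 / 100000 / Real.sqrt M := by
    refine (integral_exp_neg_mul_sq_le hl0).trans (sqrt_pi_div_le_of hM0 (by norm_num) ?_)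
    have h1 : (3141593 : ℝ) / 1000000 ≤ 2 * (125348 / 100000) ^ 2 * ρ := by nlinarith
    have h2 := Real.pi_lt_d6
    norm_num at h2
    have h3 : π * M ≤ 3141593 / 1000000 * M := by nlinarith
    have h4 : 3141593 / 1000000 * M ≤ 2 * (125348 / 100000) ^ 2 * ρ * M :=
      mul_le_mul_of_nonneg_right h1 hM
    have h5 : 2 * (125348 / 100000 : ℝ) ^ 2 * ρ * M = 4 * (125348 / 100000) ^ 2 * (ρ * M / 2) := by
      ring
    linarith
  have hT : exp (2 * (ε⁻¹ * M * (50 * M * ε ^ 3 * exp (2 * M))) - ρ * M / 2) ≤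
      1 / 100000 / Real.sqrt M := by
    have h1 : 2 * (ε⁻¹ * M * (50 * M * ε ^ 3 * exp (2 * M))) = 100 * M ^ 2 * ε ^ 2 * exp (2 * M) := by
      field_simp; ring
    rw [h1]
    have hl : 499 / 1000 * M ≤ ρ * M / 2 := by nlinarith
    exact (exp_le_exp.2 (sub_le_sub_right hsmall _)).trans (exp_tail_le hM6000 hl)
  have hs0 : 0 ≤ (ε ^ 2 * exp (-M) * exp (-ν ^ 2)) := by positivity
  have h1 := mul_le_mul_of_nonneg_left hI hs0
  have h2 := mul_le_mul_of_nonneg_left hT hs0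
  have h3 : (ε ^ 2 * exp (-M) * exp (-ν ^ 2)) * (125348 / 100000 / Real.sqrt M) +
      (ε ^ 2 * exp (-M) * exp (-ν ^ 2)) * (1 / 100000 / Real.sqrt M) =
      125349 / 100000 * ((ε ^ 2 * exp (-M) * exp (-ν ^ 2))) / Real.sqrt M := by ring
  linarith only [hsharp, h1, h2, h3.le]

end NegKick

/-- **UPPER SIDE: from `1.2535/√M` seeds the gate stalls.** The cycle-end trigger is NEGATIVE at
every pre-load `κ ∈ [(2507/2000)ε²e^{-M}/√M, 3ε²e^{-M}]`. [cite: Tao2016AveragedNS, Theorem 5.3] -/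
theorem cycleEndTrigger_neg_of_ge_fineS (hK : 2 * 20 ^ 42 * (Nat.factorial 42 : ℝ) + 16 ≤ K)
    (hML : 3000 * Real.log K ≤ M) (hMK : M ≤ K ^ 10) (hε : 0 < ε)
    (hεle : ε ≤ exp (-(10 * M)) / K ^ 100) {κ : ℝ}
    (hκ1 : 2507 / 2000 * ((ε ^ 2 * exp (-M) * exp (-ν ^ 2))) / Real.sqrt M ≤ κ) (hκ3 : κ ≤ 3 * (ε ^ 2 * exp (-M))) :
    cycleEndTriggerS K M ε ν κ < 0 := by
  obtain ⟨-, hM4, -⟩ := negKick_params hK hML hMK hε hεle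
  have hM0 : 0 < M := by linarith
  have hsq0 : 0 < Real.sqrt M := Real.sqrt_pos.2 hM0
  have hs : 0 < (ε ^ 2 * exp (-M) * exp (-ν ^ 2)) := by positivity
  have hκ0 : 0 ≤ κ := le_trans (by positivity) hκ1
  set X : ℝ → Fin 5 → ℝ := fun s => delayFlowSeed K M ε ν s (kickInit (-κ))
  have h2 := NegKick.negKick_trajectory_fineS (X := X) hK hML hMK hε hεle
    (hasDerivAt_delayFlowSeed K M ε ν _) (delayFlowSeed_zero K M ε ν _) hκ0 hκ3
  have hq : 125349 / 100000 * ((ε ^ 2 * exp (-M) * exp (-ν ^ 2))) / Real.sqrt M <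
      2507 / 2000 * ((ε ^ 2 * exp (-M) * exp (-ν ^ 2))) / Real.sqrt M :=
    div_lt_div_of_pos_right (by nlinarith) hsq0
  have hneg : X 2 2 * exp (-NegKick.clockInt ε M X 2) < 0 := by linarith
  have hpos : 0 < exp (-NegKick.clockInt ε M X 2) := exp_pos _
  have : X 2 2 < 0 := by
    by_contra h
    have h' : 0 ≤ X 2 2 := le_of_not_gt h
    nlinarith [mul_nonneg h' hpos.le]
  simpa [cycleEndTriggerS, X] using this


end Ported

/-! ## §5. The reduced-seed dud as an adversary of the member: necessity off the axes

An exact flow line of `delayCircuitSeed K M ε ν` is a pseudo-orbit of the member `delayCircuitWith K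
M ε` with forcing `e(t) = (ε²e^{-M}(1 - e^{-ν²}))·(ac, 0, -a², 0, 0)`, of sup-size at most
`ε²e^{-M}(1 - e^{-ν²})` on the unit sup-ball. The reduced-seed dud of §4 (pre-load below
`1.2535·ε²e^{-M}e^{-ν²}/√M`, output `|ã| ≤ 6e^{-M}` on the cycle) therefore refutes every reach
certificate of the member whose datum class has sup-radius `ρ ≥ 1.2535·ε²e^{-M}e^{-ν²}/√M` and whose
forcing class has sup-size `ε_d ≥ ε²e^{-M}(1 - e^{-ν²})`; eliminating `ν`: every `(ρ, ε_d)` with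
`ρ + 1.2535·ε_d/√M ≥ 1.2535·u` (`u = ε²e^{-M}/√M`), at every level `c₀` (quadratic rescaling). -/

section Adversary

/-- The reduced-seed member is a homogeneous quadratic field: `F(c • X) = c² • F(X)`.
[cite: Tao2016AveragedNS, §5.5 (5.5)] -/
theorem delayCircuitSeed_smul (K M ε ν c : ℝ) (X : Fin 5 → ℝ) :
    delayCircuitSeed K M ε ν (c • X) = c ^ 2 • delayCircuitSeed K M ε ν X := by
  funext i
  fin_cases i <;> simp [delayCircuitSeed, smul_eq_mul] <;> ring

/-- **The forcing that turns the member into the reduced-seed member**: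
`delayCircuitSeed - delayCircuitWith = ε²e^{-M}(1 - e^{-ν²})·(ac, 0, -a², 0, 0)`.
[cite: Tao2016AveragedNS, §5.5 (5.5)] -/
theorem delayCircuitSeed_sub (K M ε ν : ℝ) (X : Fin 5 → ℝ) :
    delayCircuitSeed K M ε ν X - delayCircuitWith K M ε X =
      (ε ^ 2 * exp (-M) * (1 - exp (-ν ^ 2))) • ![X 0 * X 2, 0, -(X 0 ^ 2), 0, 0] := by
  funext i
  fin_cases i <;> simp [delayCircuitSeed, delayCircuitWith, smul_eq_mul] <;> ring

/-- **Sup-size of that forcing** on the sup-ball of radius `c`: at most `c²·ε²e^{-M}(1 - e^{-ν²})`.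
[cite: Tao2016AveragedNS, §5.5 (5.5)] -/
theorem norm_delayCircuitSeed_sub_le {K M ε ν c : ℝ} {X : Fin 5 → ℝ} (hX : ‖X‖ ≤ c) :
    ‖delayCircuitSeed K M ε ν X - delayCircuitWith K M ε X‖ ≤
      c ^ 2 * (ε ^ 2 * exp (-M) * (1 - exp (-ν ^ 2))) := by
  have hc : 0 ≤ c := (norm_nonneg _).trans hX
  have h0 : |X 0| ≤ c := by simpa [Real.norm_eq_abs] using (norm_le_pi_norm X 0).trans hX
  have h2 : |X 2| ≤ c := by simpa [Real.norm_eq_abs] using (norm_le_pi_norm X 2).trans hX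
  have hθ : 0 ≤ ε ^ 2 * exp (-M) * (1 - exp (-ν ^ 2)) := by
    have : exp (-ν ^ 2) ≤ 1 := by rw [exp_le_one_iff]; nlinarith [sq_nonneg ν]
    have : 0 ≤ 1 - exp (-ν ^ 2) := by linarith
    positivity
  have hv : ‖(![X 0 * X 2, 0, -(X 0 ^ 2), 0, 0] : Fin 5 → ℝ)‖ ≤ c ^ 2 := by
    refine (pi_norm_le_iff_of_nonneg (sq_nonneg c)).2 fun i => ?_
    fin_cases i
    · simp only [Fin.zero_eta, Fin.isValue, Matrix.cons_val_zero, Real.norm_eq_abs, abs_mul]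
      calc |X 0| * |X 2| ≤ c * c := mul_le_mul h0 h2 (abs_nonneg _) hc
        _ = c ^ 2 := by ring
    · simp [sq_nonneg]
    · simp only [Fin.reduceFinMk, Fin.isValue, Matrix.cons_val, Real.norm_eq_abs, abs_neg, abs_pow,
        sq_abs]
      calc X 0 ^ 2 = |X 0| ^ 2 := (sq_abs _).symm
        _ ≤ c ^ 2 := pow_le_pow_left₀ (abs_nonneg _) h0 2
    · simp [sq_nonneg]
    · simp [sq_nonneg]
  rw [delayCircuitSeed_sub, norm_smul, Real.norm_eq_abs, abs_of_nonneg hθ]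
  calc ε ^ 2 * exp (-M) * (1 - exp (-ν ^ 2)) * ‖(![X 0 * X 2, 0, -(X 0 ^ 2), 0, 0] : Fin 5 → ℝ)‖
      ≤ ε ^ 2 * exp (-M) * (1 - exp (-ν ^ 2)) * c ^ 2 := mul_le_mul_of_nonneg_left hv hθ
    _ = c ^ 2 * (ε ^ 2 * exp (-M) * (1 - exp (-ν ^ 2))) := by ring

/-- A flow line of the reduced-seed member from a kicked datum (`κ² ≤ 1`) stays in the unit sup-ball.
[cite: Tao2016AveragedNS, §5.5 (energy-con)] -/
theorem norm_delayFlowSeed_kickInit_le_one (K M ε ν : ℝ) {κ : ℝ} (hκ : κ ^ 2 ≤ 1) (t : ℝ) :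
    ‖delayFlowSeed K M ε ν t (kickInit κ)‖ ≤ 1 := by
  simpa [energy_kickInit hκ] using norm_delayFlowSeed_le K M ε ν (kickInit κ) t

variable {K M ε : ℝ} (hK : 2 * 20 ^ 42 * (Nat.factorial 42 : ℝ) + 16 ≤ K)
  (hML : 3000 * Real.log K ≤ M) (hMK : M ≤ K ^ 10) (hε : 0 < ε)
  (hεle : ε ≤ exp (-(10 * M)) / K ^ 100)
include hK hML hMK hε hεle

/-- **The reduced-seed dud.** Under the standing hypotheses of the family's Theorem 5.3, for every
`ν` there is a pre-load `κ* ∈ [0, 1.2535·ε²e^{-M}e^{-ν²}/√M)` whose EXACT flow line under the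
reduced-seed member returns the trigger to zero at the end of the cycle, keeps it in
`[-3ε²e^{-M}, 0]`, and keeps `|d|, |ã| ≤ 6e^{-M}` on `[0,2]`: the dud threshold is proportional to
the seed that is actually deposited. [cite: Tao2016AveragedNS, §5.5 Theorem 5.3] -/
theorem exists_seedDud (ν : ℝ) :
    ∃ κ : ℝ, 0 ≤ κ ∧ κ < 2507 / 2000 * (ε ^ 2 * exp (-M) * exp (-ν ^ 2)) / Real.sqrt M ∧
      delayFlowSeed K M ε ν 2 (kickInit (-κ)) 2 = 0 ∧
      ∀ t ∈ Icc (0 : ℝ) 2,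
        delayFlowSeed K M ε ν t (kickInit (-κ)) 2 ≤ 0 ∧
        -(3 * (ε ^ 2 * exp (-M))) ≤ delayFlowSeed K M ε ν t (kickInit (-κ)) 2 ∧
        |delayFlowSeed K M ε ν t (kickInit (-κ)) 3| ≤ 6 * exp (-M) ∧
        |delayFlowSeed K M ε ν t (kickInit (-κ)) 4| ≤ 6 * exp (-M) := by
  obtain ⟨-, hM4, -⟩ := negKick_params hK hML hMK hε hεle
  have hM1 : 1 ≤ Real.sqrt M := by
    rw [show (1 : ℝ) = Real.sqrt 1 by simp]; exact Real.sqrt_le_sqrt (by linarith)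
  have hsq0 : 0 < Real.sqrt M := by linarith
  have hs : 0 ≤ ε ^ 2 * exp (-M) := by positivity
  have hν : exp (-ν ^ 2) ≤ 1 := by rw [exp_le_one_iff]; nlinarith [sq_nonneg ν]
  have hσs : ε ^ 2 * exp (-M) * exp (-ν ^ 2) ≤ ε ^ 2 * exp (-M) := mul_le_of_le_one_right hs hν
  have hL3 : 2507 / 2000 * (ε ^ 2 * exp (-M) * exp (-ν ^ 2)) / Real.sqrt M ≤
      3 * (ε ^ 2 * exp (-M)) := by
    rw [div_le_iff₀ hsq0]
    have : 0 ≤ ε ^ 2 * exp (-M) * exp (-ν ^ 2) := by positivity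
    nlinarith
  exact exists_dud_of_cycleEndTrigger_negS hK hML hMK hε hεle (by positivity) hL3
    (cycleEndTrigger_neg_of_ge_fineS hK hML hMK hε hεle le_rfl hL3)

/-- **Necessity off the axes, at every level (general classes).** Let `c₀ > 0`, `U` open, `τc ≤ 2/c₀`;
suppose the datum class contains the level-`c₀` copy of the sup-ball of radius
`ρ ≥ 1.2535·ε²e^{-M}e^{-ν²}/√M` about (5.6), the forcing budget is
`ε_d ≥ c₀²·ε²e^{-M}(1 - e^{-ν²})`, and the target class requires an output above `6c₀e^{-M}`. Then
the member admits NO reach certificate: the rescaled reduced-seed dud `t ↦ c₀·x(c₀t)` is an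
admissible pseudo-orbit (forcing `c₀²(delayCircuitSeed - delayCircuitWith)`) issued in the datum
class whose output stays `≤ 6c₀e^{-M}` up to time `2/c₀`. [cite: Tao2016AveragedNS, §5.5 Theorem 5.3, Remark 6.1] -/
theorem isEmpty_reachCertificate_of_seedDud {ν c₀ : ℝ} (hc₀ : 0 < c₀) {U : Set (Fin 5 → ℝ)}
    (hU : IsOpen U) {εd τc ρ : ℝ} (hεd : c₀ ^ 2 * (ε ^ 2 * exp (-M) * (1 - exp (-ν ^ 2))) ≤ εd)
    (hτ0 : 0 ≤ τc) (hτ2 : τc ≤ 2 / c₀)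
    {Ain Aout : Set (Fin 5 → ℝ)} (hAin : ∀ q ∈ closedBall delayInit ρ, c₀ • q ∈ Ain)
    (hρ : 2507 / 2000 * (ε ^ 2 * exp (-M) * exp (-ν ^ 2)) / Real.sqrt M ≤ ρ)
    (hAout : ∀ p ∈ Aout, 6 * c₀ * exp (-M) < p 4) :
    IsEmpty (ReachCertificate (delayCircuitWith K M ε) U εd τc Ain Aout) := by
  refine ⟨fun C => ?_⟩
  obtain ⟨-, -, -, hs3, -, -⟩ := negKick_params hK hML hMK hε hεle
  obtain ⟨κ, hκ0, hκ1, -, hdud⟩ := exists_seedDud hK hML hMK hε hεle ν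
  obtain ⟨-, hM4, -⟩ := negKick_params hK hML hMK hε hεle
  have hM1 : 1 ≤ Real.sqrt M := by
    rw [show (1 : ℝ) = Real.sqrt 1 by simp]; exact Real.sqrt_le_sqrt (by linarith)
  have hsq0 : 0 < Real.sqrt M := by linarith
  have hs : 0 ≤ ε ^ 2 * exp (-M) := by positivity
  have hν : exp (-ν ^ 2) ≤ 1 := by rw [exp_le_one_iff]; nlinarith [sq_nonneg ν]
  have hκle : κ ≤ 1 := by
    have h1 : 2507 / 2000 * (ε ^ 2 * exp (-M) * exp (-ν ^ 2)) / Real.sqrt M ≤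
        2507 / 2000 * (ε ^ 2 * exp (-M)) := by
      rw [div_le_iff₀ hsq0]
      have : 0 ≤ ε ^ 2 * exp (-M) * exp (-ν ^ 2) := by positivity
      have hσs : ε ^ 2 * exp (-M) * exp (-ν ^ 2) ≤ ε ^ 2 * exp (-M) := mul_le_of_le_one_right hs hν
      nlinarith
    linarith
  have hκsq : (-κ) ^ 2 ≤ 1 := by rw [neg_sq]; nlinarith
  have hq : kickInit (-κ) ∈ closedBall delayInit ρ := by
    rw [mem_closedBall, dist_eq_norm]
    exact (norm_kickInit_neg_sub_delayInit hκ0 hκle).trans (hκ1.le.trans hρ)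
  set x : ℝ → Fin 5 → ℝ := fun t => delayFlowSeed K M ε ν t (kickInit (-κ)) with hxdef
  set y : ℝ → Fin 5 → ℝ := fun t => c₀ • x (c₀ * t) with hydef
  have hy0 : y 0 = c₀ • kickInit (-κ) := by simp [hydef, hxdef, delayFlowSeed_zero]
  have hder : ∀ t, HasDerivAt x (delayCircuitSeed K M ε ν (x t)) t := fun t =>
    hasDerivAt_delayFlowSeed K M ε ν _ t
  have hcx : Continuous x := continuous_iff_continuousAt.2 fun t => (hder t).continuousAt
  have hcont : ContinuousOn y (Icc 0 τc) :=
    ((hcx.comp (continuous_const_mul c₀)).const_smul c₀).continuousOn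
  have hW : ∀ σ ∈ Ico 0 τc, ∃ W : Fin 5 → ℝ,
      HasDerivWithinAt y W (Ici σ) σ ∧ ‖W - delayCircuitWith K M ε (y σ)‖ ≤ εd := by
    intro σ _
    have hD := (hder (c₀ * σ)).hasDerivWithinAt (s := Ici (c₀ * σ))
    have h1 := hasDerivWithinAt_comp_mul hc₀ hD
    refine ⟨_, h1.const_smul c₀, ?_⟩
    show ‖c₀ • (c₀ • _) - delayCircuitWith K M ε (c₀ • x (c₀ * σ))‖ ≤ εd
    rw [delayCircuitWith_smul, smul_smul, ← pow_two, ← smul_sub, norm_smul, Real.norm_eq_abs,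
      abs_of_pos (pow_pos hc₀ 2)]
    have hn := norm_delayCircuitSeed_sub_le (K := K) (M := M) (ε := ε) (ν := ν)
      (norm_delayFlowSeed_kickInit_le_one K M ε ν hκsq (c₀ * σ))
    rw [one_pow, one_mul] at hn
    exact (mul_le_mul_of_nonneg_left hn (pow_pos hc₀ 2).le).trans hεd
  obtain ⟨σ, hσ, hA⟩ := C.reach hU (hAin _ hq) hτ0 hy0 hcont hW
  have h1 := hAout _ hA
  have hcσ : c₀ * σ ∈ Icc (0 : ℝ) 2 := by
    refine ⟨mul_nonneg hc₀.le hσ.1, ?_⟩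
    have := mul_le_mul_of_nonneg_left (hσ.2.trans hτ2) hc₀.le
    rwa [mul_div_cancel₀ _ hc₀.ne'] at this
  have h3 := (abs_le.1 (hdud (c₀ * σ) hcσ).2.2.2).2
  have h4 : y σ 4 = c₀ * x (c₀ * σ) 4 := by simp [hydef]
  rw [h4] at h1
  have h5 : c₀ * x (c₀ * σ) 4 ≤ c₀ * (6 * exp (-M)) := mul_le_mul_of_nonneg_left h3 hc₀.le
  linarith

/-- **Necessity off the axes for the cone classes, parametrised by the seed reduction `ν`.**
[cite: Tao2016AveragedNS, §5.5 Theorem 5.3, Remark 6.1] -/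
theorem isEmpty_taoReachCone_of_seedDud {ν c₀ εd ρ τc : ℝ} (hc₀ : 0 < c₀)
    (hεd : c₀ ^ 2 * (ε ^ 2 * exp (-M) * (1 - exp (-ν ^ 2))) ≤ εd) (hτ0 : 0 ≤ τc)
    (hτ2 : τc ≤ 2 / c₀) (hρ : 2507 / 2000 * (ε ^ 2 * exp (-M) * exp (-ν ^ 2)) / Real.sqrt M ≤ ρ) :
    IsEmpty (ReachCertificate (delayCircuitWith K M ε) (univ : Set (Fin 5 → ℝ)) εd τc
      (coneFrom c₀ (closedBall delayInit ρ)) (coneFrom c₀ (firedSet K 6 4))) := by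
  obtain ⟨hK16, -, -, -, -, hexpM⟩ := negKick_params hK hML hMK hε hεle
  have hK0 : 0 < K := by linarith
  have hK20 : (6 : ℝ) ≤ K ^ 20 / 2 := by
    have : (16 : ℝ) ≤ K ^ 20 := by
      calc (16 : ℝ) ≤ K := hK16
        _ = K ^ 1 := (pow_one K).symm
        _ ≤ K ^ 20 := pow_le_pow_right₀ (by linarith) (by norm_num)
    linarith
  refine isEmpty_reachCertificate_of_seedDud hK hML hMK hε hεle hc₀ isOpen_univ hεd hτ0 hτ2
    (fun q hq => smul_mem_coneFrom le_rfl hq) hρ fun p hp => ?_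
  have h := half_le_four_of_mem_coneFrom_firedSet hK0 hK20 hc₀.le hp
  have : 6 * c₀ * exp (-M) ≤ 6 * c₀ * (1 / 50) := mul_le_mul_of_nonneg_left hexpM (by positivity)
  linarith

/-- **THE CRITICAL LINE FROM ABOVE (every level).** For the cone classes at level `c₀ > 0` and every
cycle time `τc ≤ 2/c₀`, the member admits NO reach certificate at any `(ρ, ε_d)` (`ρ, ε_d ≥ 0`) on or
above the straight line through the two axis thresholds,
`ρ + 1.2535·(ε_d/c₀²)/√M ≥ 1.2535·u` (`u = ε²e^{-M}/√M`): below the seed axis take the reduced-seed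
dud with `e^{-ν²} = 1 - ε_d/(c₀²ε²e^{-M})`; at or beyond it the seed-free orbit
(`isEmpty_taoReachCone_of_seed_le`). [cite: Tao2016AveragedNS, §5.5 Theorem 5.3, Remark 6.1] -/
theorem isEmpty_taoReachCone_of_line_le {c₀ ρ εd τc : ℝ} (hc₀ : 0 < c₀) (hρ : 0 ≤ ρ)
    (hεd : 0 ≤ εd) (hτ0 : 0 ≤ τc) (hτ2 : τc ≤ 2 / c₀)
    (hline : 2507 / 2000 * (ε ^ 2 * exp (-M)) / Real.sqrt M ≤
      ρ + 2507 / 2000 * (εd / c₀ ^ 2) / Real.sqrt M) :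
    IsEmpty (ReachCertificate (delayCircuitWith K M ε) (univ : Set (Fin 5 → ℝ)) εd τc
      (coneFrom c₀ (closedBall delayInit ρ)) (coneFrom c₀ (firedSet K 6 4))) := by
  obtain ⟨hK16, hM4, -⟩ := negKick_params hK hML hMK hε hεle
  by_cases hax : c₀ ^ 2 * (ε ^ 2 * exp (-M)) ≤ εd
  · exact isEmpty_taoReachCone_of_seed_le (by linarith) hc₀ hρ hax hτ0
  have hlt : εd < c₀ ^ 2 * (ε ^ 2 * exp (-M)) := lt_of_not_ge hax
  have hs : 0 < ε ^ 2 * exp (-M) := by positivity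
  have hcs : 0 < c₀ ^ 2 * (ε ^ 2 * exp (-M)) := by positivity
  -- the seed reduction realising the forcing budget εd exactly
  set q : ℝ := 1 - εd / (c₀ ^ 2 * (ε ^ 2 * exp (-M))) with hqdef
  have hq0 : 0 < q := by
    rw [hqdef, sub_pos, div_lt_one hcs]; exact hlt
  have hq1 : q ≤ 1 := by
    rw [hqdef, sub_le_self_iff]; positivity
  set ν : ℝ := Real.sqrt (-Real.log q) with hνdef
  have hlog : 0 ≤ -Real.log q := by
    have := Real.log_nonpos hq0.le hq1; linarith
  have heν : exp (-ν ^ 2) = q := by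
    rw [hνdef, Real.sq_sqrt hlog, neg_neg, Real.exp_log hq0]
  have hσ : ε ^ 2 * exp (-M) * exp (-ν ^ 2) = ε ^ 2 * exp (-M) - εd / c₀ ^ 2 := by
    rw [heν, hqdef]; field_simp
  have hbud : c₀ ^ 2 * (ε ^ 2 * exp (-M) * (1 - exp (-ν ^ 2))) ≤ εd := by
    rw [heν, hqdef]
    have : c₀ ^ 2 * (ε ^ 2 * exp (-M) * (1 - (1 - εd / (c₀ ^ 2 * (ε ^ 2 * exp (-M)))))) = εd := by
      field_simp
      ring
    rw [this]
  have hsq0 : 0 < Real.sqrt M := Real.sqrt_pos.2 (by linarith)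
  have hρ' : 2507 / 2000 * (ε ^ 2 * exp (-M) * exp (-ν ^ 2)) / Real.sqrt M ≤ ρ := by
    rw [hσ]
    have e1 : 2507 / 2000 * (ε ^ 2 * exp (-M) - εd / c₀ ^ 2) / Real.sqrt M =
        2507 / 2000 * (ε ^ 2 * exp (-M)) / Real.sqrt M - 2507 / 2000 * (εd / c₀ ^ 2) / Real.sqrt M := by
      ring
    rw [e1]; linarith
  exact isEmpty_taoReachCone_of_seedDud hK hML hMK hε hεle hc₀ hbud hτ0 hτ2 hρ'

/-- **THE CRITICAL LINE FROM ABOVE, level one, ball classes** (`U = ball 0 2`,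
`Ain = closedBall delayInit ρ`, `Aout = firedSet K 6 4`, the classes of `taoReachHalfPlane`): no reach
certificate for `τc ≤ 2` once `ρ + 1.2535·ε_d/√M ≥ 1.2535·u`.
[cite: Tao2016AveragedNS, §5.5 Theorem 5.3, Remark 6.1] -/
theorem isEmpty_taoReach_of_line_le {ρ εd τc : ℝ} (hρ : 0 ≤ ρ) (hεd : 0 ≤ εd) (hτ0 : 0 ≤ τc)
    (hτ2 : τc ≤ 2)
    (hline : 2507 / 2000 * (ε ^ 2 * exp (-M)) / Real.sqrt M ≤ ρ + 2507 / 2000 * εd / Real.sqrt M) :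
    IsEmpty (ReachCertificate (delayCircuitWith K M ε) (ball (0 : Fin 5 → ℝ) 2) εd τc
      (closedBall delayInit ρ) (firedSet K 6 4)) := by
  obtain ⟨hK16, hM4, -, -, -, hexpM⟩ := negKick_params hK hML hMK hε hεle
  have hK0 : 0 < K := by linarith
  have hK20 : (6 : ℝ) ≤ K ^ 20 / 2 := by
    have : (16 : ℝ) ≤ K ^ 20 := by
      calc (16 : ℝ) ≤ K := hK16
        _ = K ^ 1 := (pow_one K).symm
        _ ≤ K ^ 20 := pow_le_pow_right₀ (by linarith) (by norm_num)
    linarith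
  have hAout : ∀ p ∈ firedSet K 6 4, 6 * 1 * exp (-M) < p 4 := fun p hp => by
    have h := firedSet_subset_half hK0 hK20 hp
    simp only [mem_setOf_eq] at h
    linarith
  by_cases hax : ε ^ 2 * exp (-M) ≤ εd
  · exact isEmpty_reachCertificate_of_seed_le isOpen_ball hax hτ0 (mem_closedBall_self hρ)
      fun p hp => by have := hAout p hp; intro h0; rw [h0] at this; linarith [exp_pos (-M)]
  have hlt : εd < ε ^ 2 * exp (-M) := lt_of_not_ge hax
  have hs : 0 < ε ^ 2 * exp (-M) := by positivity
  set q : ℝ := 1 - εd / (ε ^ 2 * exp (-M)) with hqdef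
  have hq0 : 0 < q := by
    rw [hqdef, sub_pos, div_lt_one hs]; exact hlt
  have hq1 : q ≤ 1 := by
    rw [hqdef, sub_le_self_iff]; positivity
  set ν : ℝ := Real.sqrt (-Real.log q) with hνdef
  have hlog : 0 ≤ -Real.log q := by
    have := Real.log_nonpos hq0.le hq1; linarith
  have heν : exp (-ν ^ 2) = q := by
    rw [hνdef, Real.sq_sqrt hlog, neg_neg, Real.exp_log hq0]
  have hσ : ε ^ 2 * exp (-M) * exp (-ν ^ 2) = ε ^ 2 * exp (-M) - εd := by
    rw [heν, hqdef]; field_simp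
  have hbud : (1 : ℝ) ^ 2 * (ε ^ 2 * exp (-M) * (1 - exp (-ν ^ 2))) ≤ εd := by
    rw [heν, hqdef]
    have : (1 : ℝ) ^ 2 * (ε ^ 2 * exp (-M) * (1 - (1 - εd / (ε ^ 2 * exp (-M))))) = εd := by
      field_simp
      ring
    rw [this]
  have hsq0 : 0 < Real.sqrt M := Real.sqrt_pos.2 (by linarith)
  have hρ' : 2507 / 2000 * (ε ^ 2 * exp (-M) * exp (-ν ^ 2)) / Real.sqrt M ≤ ρ := by
    rw [hσ]
    have e1 : 2507 / 2000 * (ε ^ 2 * exp (-M) - εd) / Real.sqrt M =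
        2507 / 2000 * (ε ^ 2 * exp (-M)) / Real.sqrt M - 2507 / 2000 * εd / Real.sqrt M := by
      ring
    rw [e1]; linarith
  exact isEmpty_reachCertificate_of_seedDud hK hML hMK hε hεle one_pos isOpen_ball hbud hτ0
    (by simpa using hτ2) (fun q hq => by simpa using hq) hρ' hAout

/-- **THE TOLERANCE PORTRAIT OF TAO'S GATE IS DECIDED UP TO A WEDGE OF RELATIVE WIDTH `1.35 %`**
(level one, ball classes, `u = ε²e^{-M}/√M`, `s = ε²e^{-M}`): a reach certificate EXISTS (cycle time
`2`) at every `(ρ, ε_d)` strictly below the line `ρ + 1.27·ε_d/√M = 1.2532·u`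
(`taoReachHalfPlane`), and NONE exists (any cycle time `≤ 2`) at any `(ρ, ε_d)` on or above the
parallel-up-to-`1.3 %` line `ρ + 1.2535·ε_d/√M = 1.2535·u` — the straight line through the two axis
thresholds `(1.2535·u, 0)` and `(0, s)`. The critical curve of the gate's datum/forcing tolerance is a
straight line to within `1.35 %`, at every point of the quadrant. [cite: Tao2016AveragedNS, §5.5 Theorem 5.3, Remark 6.1] -/
theorem taoReach_phases_line {ρ εd : ℝ} (hρ : 0 ≤ ρ) (hεd : 0 ≤ εd) :
    (ρ + 127 / 100 * εd / Real.sqrt M < 3133 / 2500 * (ε ^ 2 * exp (-M)) / Real.sqrt M →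
        Nonempty (ReachCertificate (delayCircuitWith K M ε) (ball (0 : Fin 5 → ℝ) 2) εd 2
          (closedBall delayInit ρ) (firedSet K 6 4))) ∧
    (2507 / 2000 * (ε ^ 2 * exp (-M)) / Real.sqrt M ≤ ρ + 2507 / 2000 * εd / Real.sqrt M →
        ∀ τc : ℝ, 0 ≤ τc → τc ≤ 2 →
          IsEmpty (ReachCertificate (delayCircuitWith K M ε) (ball (0 : Fin 5 → ℝ) 2) εd τc
            (closedBall delayInit ρ) (firedSet K 6 4))) :=
  ⟨fun hW => ⟨taoReachHalfPlane hK hML hMK hε hεle hρ hεd hW⟩,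
    fun hl _ h0 h2 => isEmpty_taoReach_of_line_le hK hML hMK hε hεle hρ hεd h0 h2 hl⟩

/-- **The same portrait at every level `c₀ > 0`** (cone classes, cycle time `2/c₀`, forcing read at
level one as `ε_d/c₀²`): certified strictly below `ρ + 1.27·(ε_d/c₀²)/√M = 1.2532·u`
(`taoReachCone_wide`), impossible on or above `ρ + 1.2535·(ε_d/c₀²)/√M = 1.2535·u` for every cycle
time `≤ 2/c₀`. [cite: Tao2016AveragedNS, §5.5 Theorem 5.3, Remark 6.1] -/
theorem taoReachCone_phases_line {c₀ ρ εd : ℝ} (hc₀ : 0 < c₀) (hρ : 0 ≤ ρ) (hεd : 0 ≤ εd) :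
    (ρ + 127 / 100 * (εd / c₀ ^ 2) / Real.sqrt M < 3133 / 2500 * (ε ^ 2 * exp (-M)) / Real.sqrt M →
        Nonempty (ReachCertificate (delayCircuitWith K M ε) (univ : Set (Fin 5 → ℝ)) εd (2 / c₀)
          (coneFrom c₀ (closedBall delayInit ρ)) (coneFrom c₀ (firedSet K 6 4)))) ∧
    (2507 / 2000 * (ε ^ 2 * exp (-M)) / Real.sqrt M ≤ ρ + 2507 / 2000 * (εd / c₀ ^ 2) / Real.sqrt M →
        ∀ τc : ℝ, 0 ≤ τc → τc ≤ 2 / c₀ →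
          IsEmpty (ReachCertificate (delayCircuitWith K M ε) (univ : Set (Fin 5 → ℝ)) εd τc
            (coneFrom c₀ (closedBall delayInit ρ)) (coneFrom c₀ (firedSet K 6 4)))) :=
  ⟨fun hW => ⟨taoReachCone_wide hK hML hMK hε hεle hc₀ hρ hεd hW⟩,
    fun hl _ h0 h2 => isEmpty_taoReachCone_of_line_le hK hML hMK hε hεle hc₀ hρ hεd h0 h2 hl⟩

/-- **The undecided wedge is thin**: a point `(ρ, ε_d)` of the quadrant that is neither certified by
`taoReach_phases_line` nor refuted by it satisfies
`1.2532·u ≤ ρ + 1.27·ε_d/√M` and `ρ + 1.2535·ε_d/√M < 1.2535·u`, whence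
`1.2532·u - 0.0165·ε_d/√M ≤ ρ + 1.2535·ε_d/√M < 1.2535·u` with `ε_d < s`: a sliver between two
straight lines whose intercepts differ by the factors `1.2535/1.2532` (pre-load axis) and
`1/0.98669` (seed axis, cf. `defectAxis_phases_wide`). [cite: Tao2016AveragedNS, §5.5 Theorem 5.3] -/
theorem undecided_wedge {ρ εd : ℝ} (hρ : 0 ≤ ρ) (hεd : 0 ≤ εd)
    (h1 : ¬ ρ + 127 / 100 * εd / Real.sqrt M < 3133 / 2500 * (ε ^ 2 * exp (-M)) / Real.sqrt M)
    (h2 : ¬ 2507 / 2000 * (ε ^ 2 * exp (-M)) / Real.sqrt M ≤ ρ + 2507 / 2000 * εd / Real.sqrt M) :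
    3133 / 2500 * (ε ^ 2 * exp (-M)) / Real.sqrt M - 33 / 2000 * εd / Real.sqrt M ≤
        ρ + 2507 / 2000 * εd / Real.sqrt M ∧
      ρ + 2507 / 2000 * εd / Real.sqrt M < 2507 / 2000 * (ε ^ 2 * exp (-M)) / Real.sqrt M ∧
      εd < ε ^ 2 * exp (-M) ∧ ρ < 2507 / 2000 * (ε ^ 2 * exp (-M)) / Real.sqrt M := by
  obtain ⟨-, hM4, -⟩ := negKick_params hK hML hMK hε hεle
  have hsq0 : 0 < Real.sqrt M := Real.sqrt_pos.2 (by linarith)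
  have hs : 0 ≤ ε ^ 2 * exp (-M) := by positivity
  push Not at h1 h2
  have e1 : 3133 / 2500 * (ε ^ 2 * exp (-M)) / Real.sqrt M - 33 / 2000 * εd / Real.sqrt M =
      (3133 / 2500 * (ε ^ 2 * exp (-M)) - 33 / 2000 * εd) / Real.sqrt M := by ring
  have e2 : ρ + 2507 / 2000 * εd / Real.sqrt M = (ρ * Real.sqrt M + 2507 / 2000 * εd) / Real.sqrt M := by
    field_simp
  have e3 : ρ + 127 / 100 * εd / Real.sqrt M = (ρ * Real.sqrt M + 127 / 100 * εd) / Real.sqrt M := by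
    field_simp
  rw [e3, div_le_div_iff_of_pos_right hsq0] at h1
  rw [e2, div_lt_div_iff_of_pos_right hsq0] at h2
  have hεd' : 0 ≤ εd / Real.sqrt M := by positivity
  refine ⟨?_, ?_, ?_, ?_⟩
  · rw [e1, e2, div_le_div_iff_of_pos_right hsq0]; linarith
  · rw [e2, div_lt_div_iff_of_pos_right hsq0]; exact h2
  · have hρ0 : 0 ≤ ρ * Real.sqrt M := mul_nonneg hρ hsq0.le
    nlinarith
  · rw [lt_div_iff₀ hsq0]; nlinarith

end Adversary

end Literature.Analysis.FluidPDE.Tao2016AveragedNS
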